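import Summits.Parity.GeneralizedHardyLittlewood.Theses.LiouvilleShiftedTables
import Summits.Parity.GeneralizedHardyLittlewood.Theorems.TableChowla.Negative.TableChowlaExceptionalSet

/-!
# Disproof of `TableChowla` (stmt-Parity-14270) — companion work file: BANDS, COLUMN BANDS, CORNERS

Second crux work file of the standing adversary (cdisprove gen 2), split off `Disproof.lean` for
size. It builds on the LANDED negative/support modules `Theorems/TableChowla/Negative/*`
(namespace `Summit.Parity.GeneralizedHardyLittlewood.Theorems.TableChowla.Negative`: `lam`,
`rowCorr`, `momentN`, `moment`, `TableChowlaFor`, `tableChowla_iff`, …, verbatim copies of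
`Disproof.lean` (a)–(i)) and contains:

* (j) BAND DOMINATION by a finite van der Corput inequality across the ROWS (`vdC_pointwise`,
  `vdC_momentN : H·T ≤ (A₂+H−1−A₁)·T_band(H)`), the band reductions `tableChowla_of_bandBound`,
  `tableChowla_of_nearDiagonal : NearDiagonalChowla → TableChowla`, the symmetric split
  `bandMomentN_le_diag_add_slopes`, and `IdeaR1.tableChowla_of_bandChowla : BandChowla →
  TableChowla` on the VERBATIM transfer target of crux idea `slope-band-vdc` — its sorried first
  lemma `band_reduction`, PROVED;
* (l) COLUMN BAND DOMINATION (`vdC_momentN_cols : K·T ≤ (B+K−1)·T_colband(K)`) and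
  `tableChowla_of_columnNearDiagonal : ColumnNearDiagonalChowla → TableChowla` — a
  `(log x)^{K−1}` mean-square saving in the SHORT two-form sums `Σ_{a∼A} λ(ab+c)λ(ab'+c)` over
  near-by column pairs proves the crux (Matomäki–Radziwiłł-shaped sufficient condition, new here);
* (m) CORNER (LOCAL BOX) DOMINATION by double van der Corput (`corner_domination`) and
  `tableChowla_of_offAxesCorners : OffAxesCornerChowla → TableChowla` — the first lemma of crux
  idea `corner-local-box` PROVED with its hypothesis REPAIRED (both gaps non-zero, restricted
  corners); the card's own `LocalBoxChowla` is refuted in `Disproof.lean` (g).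
-/

namespace Summit.Parity.GeneralizedHardyLittlewood.Cruxes.TableChowla.DisproofBands

open Finset Real ArithmeticFunction
open Summit.Parity.GeneralizedHardyLittlewood.Theses
open Summit.Parity.GeneralizedHardyLittlewood.Theorems.TableChowla
open Summit.Parity.GeneralizedHardyLittlewood.Theorems.TableChowla.Negative

noncomputable section

variable {f : ℕ → ℝ} {c : ℤ} {A₁ A₂ B : ℕ}

/-! ## (j) BAND DOMINATION (van der Corput across the rows, exact and elementary):
`H · T ≤ (N + H − 1) · T_band(H)`, where `T_band(H)` keeps only the row pairs at distance `< H`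
(diagonal included). With `H = (log x)^{C+2}` the whole log-power claim is carried by the
`≍ A·H` near-diagonal pairs — this PROVES (a sharper, rows-restricted form of) the first lemma
`band_reduction` of card `slope-band-vdc` (sorried in `SketchIdeator3.lean`). The far pairs are
slaved to the near ones; the converse fails (the crux controls band pairs only inside the full
average). -/

section vdC

variable {I M : Finset ℕ} {H : ℕ}

/-- A full window `[a, a+H)` inside `M` has exactly `H` points. -/
theorem card_window_eq {a : ℕ} (haM : ∀ m, a ≤ m → m < a + H → m ∈ M) :
    (M.filter (fun m => a ≤ m ∧ m < a + H)).card = H := by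
  have : M.filter (fun m => a ≤ m ∧ m < a + H) = Finset.Ico a (a + H) := by
    ext m
    simp only [mem_filter, Finset.mem_Ico]
    constructor
    · rintro ⟨_, h1, h2⟩; exact ⟨h1, h2⟩
    · rintro ⟨h1, h2⟩; exact ⟨haM m h1 h2, h1, h2⟩
  rw [this, Nat.card_Ico]
  omega

/-- POINTWISE van der Corput with window-overlap weights
`w(a,a') = #{m ∈ M : m ∈ [a,a+H) ∩ [a',a'+H)}`:
`H² (Σ_{a∈I} u a)² ≤ |M| · Σ_{a,a'∈I} u a · u a' · w(a,a')`, whenever every window of `I` lies in `M`. -/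
theorem vdC_pointwise (u : ℕ → ℝ) (hIM : ∀ a ∈ I, ∀ m, a ≤ m → m < a + H → m ∈ M) :
    (H : ℝ) ^ 2 * (∑ a ∈ I, u a) ^ 2 ≤ (M.card : ℝ) * ∑ a ∈ I, ∑ a' ∈ I,
      u a * u a' * ((M.filter (fun m => (a ≤ m ∧ m < a + H) ∧ (a' ≤ m ∧ m < a' + H))).card : ℝ) := by
  set W : ℕ → ℝ := fun m => ∑ a ∈ I, if a ≤ m ∧ m < a + H then u a else 0 with hW
  have hsum : ∑ m ∈ M, W m = H * ∑ a ∈ I, u a := by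
    simp only [hW]
    rw [sum_comm, mul_sum]
    refine sum_congr rfl fun a ha => ?_
    rw [← sum_filter, sum_const, nsmul_eq_mul, card_window_eq (hIM a ha)]
  have hsq : ∑ m ∈ M, W m ^ 2 = ∑ a ∈ I, ∑ a' ∈ I,
      u a * u a' * ((M.filter (fun m => (a ≤ m ∧ m < a + H) ∧ (a' ≤ m ∧ m < a' + H))).card : ℝ) := by
    simp only [hW]
    simp_rw [sq, sum_mul_sum]
    rw [sum_comm]
    refine sum_congr rfl fun a _ => ?_
    rw [sum_comm]
    refine sum_congr rfl fun a' _ => ?_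
    simp_rw [ite_zero_mul_ite_zero]
    rw [← sum_filter, sum_const, nsmul_eq_mul]
    ring
  have hcs : (∑ m ∈ M, W m) ^ 2 ≤ (M.card : ℝ) * ∑ m ∈ M, W m ^ 2 := by
    have := sum_mul_sq_le_sq_mul_sq M (fun _ => (1 : ℝ)) W
    simpa using this
  calc (H : ℝ) ^ 2 * (∑ a ∈ I, u a) ^ 2 = (∑ m ∈ M, W m) ^ 2 := by rw [hsum]; ring
    _ ≤ (M.card : ℝ) * ∑ m ∈ M, W m ^ 2 := hcs
    _ = _ := by rw [hsq]

/-- The overlap weight vanishes off the band `|a − a'| < H` … -/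
theorem card_overlap_eq_zero {a a' : ℕ} (h : ¬ (a' < a + H ∧ a < a' + H)) :
    (M.filter (fun m => (a ≤ m ∧ m < a + H) ∧ (a' ≤ m ∧ m < a' + H))).card = 0 := by
  rw [Finset.card_eq_zero, Finset.filter_eq_empty_iff]
  intro m _ hm
  apply h
  omega

/-- … and is at most `H` on it. -/
theorem card_overlap_le {a a' : ℕ} (haM : ∀ m, a ≤ m → m < a + H → m ∈ M) :
    (M.filter (fun m => (a ≤ m ∧ m < a + H) ∧ (a' ≤ m ∧ m < a' + H))).card ≤ H := by
  calc (M.filter (fun m => (a ≤ m ∧ m < a + H) ∧ (a' ≤ m ∧ m < a' + H))).card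
      ≤ (M.filter (fun m => a ≤ m ∧ m < a + H)).card := by
        apply card_le_card
        intro m hm
        simp only [mem_filter] at hm ⊢
        exact ⟨hm.1, hm.2.1⟩
    _ = H := card_window_eq haM

end vdC

/-- BAND fourth moment: only row pairs at distance `< H` (diagonal included). -/
def bandMomentN (f : ℕ → ℝ) (c : ℤ) (A₁ A₂ B H : ℕ) : ℝ :=
  ∑ a ∈ Ioc A₁ A₂, ∑ a' ∈ (Ioc A₁ A₂).filter (fun a' => a' < a + H ∧ a < a' + H),
    rowCorr f c B a a' ^ 2

/-- **BAND DOMINATION** (van der Corput across the rows, summed over column pairs):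
`H · T ≤ (A₂ + H − 1 − A₁) · T_band(H)` for every `H ≥ 1`. -/
theorem vdC_momentN {H : ℕ} (hH : 1 ≤ H) :
    (H : ℝ) * momentN f c A₁ A₂ B ≤ ((A₂ + H - 1 - A₁ : ℕ) : ℝ) * bandMomentN f c A₁ A₂ B H := by
  set I : Finset ℕ := Ioc A₁ A₂ with hI
  set M : Finset ℕ := Icc (A₁ + 1) (A₂ + H - 1) with hM
  have hIM : ∀ a ∈ I, ∀ m, a ≤ m → m < a + H → m ∈ M := by
    intro a ha m h1 h2
    rw [hI, mem_Ioc] at ha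
    rw [hM, mem_Icc]
    omega
  have hMcard : (M.card : ℝ) = ((A₂ + H - 1 - A₁ : ℕ) : ℝ) := by
    rw [hM, Nat.card_Icc]
    congr 1
    omega
  set e : ℕ → ℕ → ℝ := fun a b => f (Int.toNat ((a : ℤ) * b + c)) with he
  set w : ℕ → ℕ → ℝ := fun a a' =>
    ((M.filter (fun m => (a ≤ m ∧ m < a + H) ∧ (a' ≤ m ∧ m < a' + H))).card : ℝ) with hw
  -- Step 1: H² T ≤ |M| Σ_{a,a'} w(a,a') S(a,a')²
  have step1 : (H : ℝ) ^ 2 * momentN f c A₁ A₂ B ≤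
      (M.card : ℝ) * ∑ a ∈ I, ∑ a' ∈ I, w a a' * rowCorr f c B a a' ^ 2 := by
    have hpt : ∀ b b' : ℕ, (H : ℝ) ^ 2 * (∑ a ∈ I, e a b * e a b') ^ 2 ≤
        (M.card : ℝ) * ∑ a ∈ I, ∑ a' ∈ I, (e a b * e a b') * (e a' b * e a' b') * w a a' :=
      fun b b' => vdC_pointwise (fun a => e a b * e a b') hIM
    have hT : momentN f c A₁ A₂ B = ∑ b ∈ Icc 1 B, ∑ b' ∈ Icc 1 B, (∑ a ∈ I, e a b * e a b') ^ 2 := by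
      rw [momentN_eq_colMoment]
    rw [hT, mul_sum]
    simp_rw [mul_sum (s := Icc 1 B) (a := (H : ℝ) ^ 2)]
    calc ∑ b ∈ Icc 1 B, ∑ b' ∈ Icc 1 B, (H : ℝ) ^ 2 * (∑ a ∈ I, e a b * e a b') ^ 2
        ≤ ∑ b ∈ Icc 1 B, ∑ b' ∈ Icc 1 B,
            (M.card : ℝ) * ∑ a ∈ I, ∑ a' ∈ I, (e a b * e a b') * (e a' b * e a' b') * w a a' :=
          sum_le_sum fun b _ => sum_le_sum fun b' _ => hpt b b'
      _ = (M.card : ℝ) * ∑ a ∈ I, ∑ a' ∈ I, w a a' * rowCorr f c B a a' ^ 2 := by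
          rw [mul_sum]
          simp_rw [mul_sum (a := (M.card : ℝ))]
          -- bubble the row sums (over I) outside the column sums (over Icc 1 B)
          simp_rw [sum_comm (s := Icc 1 B) (t := I)]
          refine sum_congr rfl fun a _ => sum_congr rfl fun a' _ => ?_
          simp_rw [← mul_sum]
          congr 1
          unfold rowCorr
          rw [sq, sum_mul_sum, mul_sum]
          refine sum_congr rfl fun b _ => ?_
          rw [mul_sum]
          refine sum_congr rfl fun b' _ => ?_
          simp only [he]
          ring
  -- Step 2: Σ_{a,a'} w S² ≤ H · T_band(H)
  have step2 : ∑ a ∈ I, ∑ a' ∈ I, w a a' * rowCorr f c B a a' ^ 2 ≤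
      (H : ℝ) * bandMomentN f c A₁ A₂ B H := by
    unfold bandMomentN
    rw [← hI, mul_sum]
    refine sum_le_sum fun a ha => ?_
    rw [mul_sum, ← sum_filter_add_sum_filter_not I (fun a' => a' < a + H ∧ a < a' + H)]
    have hzero : ∑ a' ∈ I.filter (fun a' => ¬ (a' < a + H ∧ a < a' + H)),
        w a a' * rowCorr f c B a a' ^ 2 = 0 := by
      refine sum_eq_zero fun a' ha' => ?_
      have hna := (mem_filter.mp ha').2
      simp only [hw, card_overlap_eq_zero hna, Nat.cast_zero, zero_mul]
    rw [hzero, add_zero]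
    refine sum_le_sum fun a' _ => ?_
    have hwle : w a a' ≤ H := by
      simp only [hw]
      exact_mod_cast card_overlap_le (hIM a ha)
    exact mul_le_mul_of_nonneg_right hwle (sq_nonneg _)
  -- combine: H² T ≤ |M| H T_band, divide by H
  have hHpos : (0 : ℝ) < H := by exact_mod_cast hH
  have hcomb : (H : ℝ) ^ 2 * momentN f c A₁ A₂ B ≤ (H : ℝ) * (((A₂ + H - 1 - A₁ : ℕ) : ℝ) * bandMomentN f c A₁ A₂ B H) := by
    calc (H : ℝ) ^ 2 * momentN f c A₁ A₂ B
        ≤ (M.card : ℝ) * ∑ a ∈ I, ∑ a' ∈ I, w a a' * rowCorr f c B a a' ^ 2 := step1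
      _ ≤ (M.card : ℝ) * ((H : ℝ) * bandMomentN f c A₁ A₂ B H) :=
          mul_le_mul_of_nonneg_left step2 (Nat.cast_nonneg _)
      _ = (H : ℝ) * (((A₂ + H - 1 - A₁ : ℕ) : ℝ) * bandMomentN f c A₁ A₂ B H) := by rw [hMcard]; ring
  rw [sq, mul_assoc] at hcomb
  exact le_of_mul_le_mul_left hcomb hHpos


/-- NEAR-DIAGONAL CHOWLA (rows-restricted symmetric band, diagonal included, the card's budget
`x² log x / A`): `T_band((log x)^K) ≤ x² log x / A` for every `K`. The card's `BandChowla`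
(one-sided slopes `h ∈ [1,(log x)^K]`, `a + h` allowed beyond the rows) implies it up to the
harmless factor `rows·B² + 2·band ≤ 4x² log x/A` by the symmetry `S(a,a') = S(a',a)` (paper). -/
def NearDiagonalChowla : Prop :=
  ∀ c : ℤ, c ≠ 0 → ∀ δ : ℝ, 0 < δ → δ ≤ 1 / 12 → ∀ K : ℝ, 0 < K → ∃ x₀ : ℝ, ∀ x : ℝ, x₀ ≤ x →
    ∀ A : ℝ, x ^ δ ≤ A → A ≤ x ^ (1 / 3 + δ) →
      bandMomentN lam c ⌊A⌋₊ ⌊2 * A⌋₊ ⌊x / A⌋₊ ⌊Real.log x ^ K⌋₊ ≤ x ^ 2 * Real.log x / A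

/-- **BAND REDUCTION, general form**: if for every `K` the band moment at width
`H = ⌊(log x)^K⌋ + s` (`s ≤ 1`) is eventually `≤ M·x² log x/A` in the window, then `TableChowla`
(take `K = C + 2`: band domination gives `T ≤ ((rows + H − 1)/H)·M x² log x/A ≤ 6M x²/(log x)^{C+1}`). -/
theorem tableChowla_of_bandBound {M : ℝ} (hM : 1 ≤ M) {s : ℕ} (hs : s ≤ 1)
    (h : ∀ c : ℤ, c ≠ 0 → ∀ δ : ℝ, 0 < δ → δ ≤ 1 / 12 → ∀ K : ℝ, 0 < K → ∃ x₀ : ℝ, ∀ x : ℝ, x₀ ≤ x →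
      ∀ A : ℝ, x ^ δ ≤ A → A ≤ x ^ (1 / 3 + δ) →
        bandMomentN lam c ⌊A⌋₊ ⌊2 * A⌋₊ ⌊x / A⌋₊ (⌊Real.log x ^ K⌋₊ + s) ≤ M * x ^ 2 * Real.log x / A) :
    LiouvilleShiftedTables.TableChowla := by
  rw [tableChowla_iff]
  intro c hc δ hδ hδ' C hC
  obtain ⟨x₀, hx₀⟩ := h c hc δ hδ hδ' (C + 2) (by linarith)
  obtain ⟨X₁, hX₁⟩ := eventually_log_rpow_le hδ (C + 2)
  refine ⟨max (max x₀ 1) (max X₁ (Real.exp (6 * M))), fun x hx A hA hA' => ?_⟩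
  have hx₀x : x₀ ≤ x := le_trans (le_trans (le_max_left _ _) (le_max_left _ _)) hx
  have hx1 : 1 ≤ x := le_trans (le_trans (le_max_right _ _) (le_max_left _ _)) hx
  have hxX₁ : X₁ ≤ x := le_trans (le_trans (le_max_left _ _) (le_max_right _ _)) hx
  have hxe : Real.exp (6 * M) ≤ x := le_trans (le_trans (le_max_right _ _) (le_max_right _ _)) hx
  have hxpos : 0 < x := by linarith
  have hlog6 : 6 * M ≤ Real.log x := (Real.le_log_iff_exp_le hxpos).mpr hxe
  have hlogpos : 0 < Real.log x := by nlinarith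
  obtain ⟨h4, _⟩ := hX₁ x hxX₁
  have hAone : 1 ≤ A := le_trans (Real.one_le_rpow hx1 hδ.le) hA
  have hApos : 0 < A := by linarith
  set Lr : ℝ := Real.log x ^ (C + 2) with hLr
  have hLr6 : 6 ≤ Lr := by
    calc (6 : ℝ) ≤ Real.log x := by nlinarith
      _ = Real.log x ^ (1 : ℝ) := (Real.rpow_one _).symm
      _ ≤ Lr := by rw [hLr]; exact Real.rpow_le_rpow_of_exponent_le (by nlinarith) (by linarith)
  set H : ℕ := ⌊Lr⌋₊ + s with hHdef
  have hH1 : 1 ≤ H := by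
    have : 1 ≤ ⌊Lr⌋₊ := by rw [Nat.one_le_floor_iff]; linarith
    omega
  have hfl : (⌊Lr⌋₊ : ℝ) ≤ Lr := Nat.floor_le (by linarith)
  have hHle : (H : ℝ) ≤ Lr + 1 := by
    rw [hHdef]; push_cast
    have : (s : ℝ) ≤ 1 := by exact_mod_cast hs
    linarith
  have hHge : Lr / 2 ≤ H := by
    have := Nat.lt_floor_add_one Lr
    rw [hHdef]; push_cast
    have : (0 : ℝ) ≤ s := Nat.cast_nonneg s
    linarith
  have hHpos : (0 : ℝ) < H := by exact_mod_cast hH1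
  have hLrA : Lr ≤ A := by linarith
  have hband := hx₀ x hx₀x A hA hA'
  rw [← hLr, ← hHdef] at hband
  have hvdc := vdC_momentN (f := lam) (c := c) (A₁ := ⌊A⌋₊) (A₂ := ⌊2 * A⌋₊) (B := ⌊x / A⌋₊) hH1
  have hrows : ((⌊2 * A⌋₊ + H - 1 - ⌊A⌋₊ : ℕ) : ℝ) ≤ 3 * A := by
    have h1 : (⌊2 * A⌋₊ : ℝ) ≤ 2 * A := Nat.floor_le (by linarith)
    have h2 : ((⌊2 * A⌋₊ + H - 1 - ⌊A⌋₊ : ℕ) : ℝ) ≤ ((⌊2 * A⌋₊ + H - 1 : ℕ) : ℝ) := by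
      exact_mod_cast (show ⌊2 * A⌋₊ + H - 1 - ⌊A⌋₊ ≤ ⌊2 * A⌋₊ + H - 1 by omega)
    have h3 : ((⌊2 * A⌋₊ + H - 1 : ℕ) : ℝ) = (⌊2 * A⌋₊ : ℝ) + H - 1 := by
      rw [Nat.cast_sub (by omega)]; push_cast; ring
    rw [h3] at h2
    linarith
  have hbandnn : 0 ≤ bandMomentN lam c ⌊A⌋₊ ⌊2 * A⌋₊ ⌊x / A⌋₊ H :=
    sum_nonneg fun _ _ => sum_nonneg fun _ _ => sq_nonneg _
  have hHT : (H : ℝ) * momentN lam c ⌊A⌋₊ ⌊2 * A⌋₊ ⌊x / A⌋₊ ≤ 3 * M * x ^ 2 * Real.log x := by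
    calc (H : ℝ) * momentN lam c ⌊A⌋₊ ⌊2 * A⌋₊ ⌊x / A⌋₊
        ≤ ((⌊2 * A⌋₊ + H - 1 - ⌊A⌋₊ : ℕ) : ℝ) * bandMomentN lam c ⌊A⌋₊ ⌊2 * A⌋₊ ⌊x / A⌋₊ H := hvdc
      _ ≤ (3 * A) * (M * x ^ 2 * Real.log x / A) := mul_le_mul hrows hband hbandnn (by positivity)
      _ = 3 * M * x ^ 2 * Real.log x := by field_simp
  have hsplit : Lr = Real.log x ^ C * Real.log x ^ 2 := by
    rw [hLr, Real.rpow_add hlogpos, Real.rpow_two]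
  show momentN lam c ⌊A⌋₊ ⌊2 * A⌋₊ ⌊x / A⌋₊ ≤ x ^ 2 / Real.log x ^ C
  have hLpos : 0 < Real.log x ^ C := Real.rpow_pos_of_pos hlogpos C
  rw [le_div_iff₀ hLpos]
  have hT0 : 0 ≤ momentN lam c ⌊A⌋₊ ⌊2 * A⌋₊ ⌊x / A⌋₊ := momentN_nonneg
  have h1 : Lr * momentN lam c ⌊A⌋₊ ⌊2 * A⌋₊ ⌊x / A⌋₊ ≤ 6 * M * x ^ 2 * Real.log x := by
    nlinarith [mul_le_mul_of_nonneg_right hHge hT0]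
  rw [hsplit] at h1
  have hl2 : 0 < Real.log x ^ 2 := by positivity
  have h2 : momentN lam c ⌊A⌋₊ ⌊2 * A⌋₊ ⌊x / A⌋₊ * Real.log x ^ C * Real.log x ^ 2 ≤
      x ^ 2 * Real.log x ^ 2 := by
    have hx2l : (0 : ℝ) ≤ x ^ 2 * Real.log x := by positivity
    calc momentN lam c ⌊A⌋₊ ⌊2 * A⌋₊ ⌊x / A⌋₊ * Real.log x ^ C * Real.log x ^ 2
        = Real.log x ^ C * Real.log x ^ 2 * momentN lam c ⌊A⌋₊ ⌊2 * A⌋₊ ⌊x / A⌋₊ := by ring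
      _ ≤ 6 * M * x ^ 2 * Real.log x := h1
      _ = (6 * M) * (x ^ 2 * Real.log x) := by ring
      _ ≤ Real.log x * (x ^ 2 * Real.log x) := mul_le_mul_of_nonneg_right hlog6 hx2l
      _ = x ^ 2 * Real.log x ^ 2 := by ring
  exact le_of_mul_le_mul_right h2 hl2

/-- **BAND REDUCTION, PROVED**: `NearDiagonalChowla → TableChowla`. -/
theorem tableChowla_of_nearDiagonal (h : NearDiagonalChowla) : LiouvilleShiftedTables.TableChowla :=
  tableChowla_of_bandBound (M := 1) le_rfl (s := 0) (by norm_num) fun c hc δ hδ hδ' K hK => by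
    obtain ⟨x₀, hx₀⟩ := h c hc δ hδ hδ' K hK
    exact ⟨x₀, fun x hx A hA hA' => by rw [add_zero, one_mul]; exact hx₀ x hx A hA hA'⟩

/-- Symmetry of the row correlations. -/
theorem rowCorr_comm (a a' : ℕ) : rowCorr f c B a a' = rowCorr f c B a' a := by
  unfold rowCorr
  exact sum_congr rfl fun b _ => mul_comm _ _

/-- SYMMETRIC SPLIT of the band: `T_band(H) ≤ diagonal + 2·Σ_{a} Σ_{1 ≤ h ≤ H−1} S(a,a+h)²`
(the one-sided slope sums of card `slope-band-vdc`, with `a + h` allowed beyond the rows). -/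
theorem bandMomentN_le_diag_add_slopes (H : ℕ) :
    bandMomentN f c A₁ A₂ B H ≤ ∑ a ∈ Ioc A₁ A₂, rowCorr f c B a a ^ 2 +
      2 * ∑ a ∈ Ioc A₁ A₂, ∑ h ∈ Icc 1 (H - 1), rowCorr f c B a (a + h) ^ 2 := by
  classical
  set I : Finset ℕ := Ioc A₁ A₂ with hI
  set g : ℕ → ℕ → ℝ := fun a a' => rowCorr f c B a a' ^ 2 with hg
  have hg0 : ∀ a a', 0 ≤ g a a' := fun _ _ => sq_nonneg _
  have hgsymm : ∀ a a', g a a' = g a' a := fun a a' => by simp only [hg, rowCorr_comm a a']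
  -- one-sided sums U a := Σ_{a' ∈ I, a < a' < a + H} g a a'
  set U : ℕ → ℝ := fun a => ∑ a' ∈ I.filter (fun a' => a < a' ∧ a' < a + H), g a a' with hU
  -- (1) pointwise split of the band filter into  {a'} ∪ {a < a'} ∪ {a' < a}
  have hsplit : ∀ a ∈ I, ∑ a' ∈ I.filter (fun a' => a' < a + H ∧ a < a' + H), g a a' ≤
      g a a + U a + ∑ a' ∈ I.filter (fun a' => a' < a ∧ a < a' + H), g a a' := by
    intro a ha
    simp only [hU]
    rw [sum_filter, sum_filter, sum_filter]
    have hdiag : g a a = ∑ a' ∈ I, if a' = a then g a a' else 0 := by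
      rw [Finset.sum_ite_eq', if_pos ha]
    rw [hdiag, ← sum_add_distrib, ← sum_add_distrib]
    refine sum_le_sum fun a' _ => ?_
    have h0 := hg0 a a'
    split_ifs <;> first | linarith | (exfalso; omega)
  -- (2) the `a' < a` part, summed over a, equals Σ_a U a (swap the names, use symmetry)
  have hswap : ∑ a ∈ I, ∑ a' ∈ I.filter (fun a' => a' < a ∧ a < a' + H), g a a' = ∑ a ∈ I, U a := by
    simp only [hU, sum_filter]
    rw [sum_comm]
    refine sum_congr rfl fun a _ => sum_congr rfl fun a' _ => ?_
    by_cases hP : a < a' ∧ a' < a + H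
    · rw [if_pos hP, if_pos ⟨hP.1, hP.2⟩, hgsymm]
    · rw [if_neg hP, if_neg (fun h => hP ⟨h.1, h.2⟩)]
  -- (3) U a ≤ Σ_{h ∈ [1,H-1]} g a (a+h)  (reindex a' = a + h)
  have hUle : ∀ a, U a ≤ ∑ h ∈ Icc 1 (H - 1), g a (a + h) := by
    intro a
    have hinj : Set.InjOn (fun h => a + h) (Icc 1 (H - 1) : Finset ℕ) := fun h _ h' _ hh => by
      simpa using hh
    rw [← sum_image hinj]
    refine sum_le_sum_of_subset_of_nonneg ?_ fun _ _ _ => hg0 _ _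
    intro a' ha'
    simp only [mem_filter] at ha'
    rw [mem_image]
    refine ⟨a' - a, ?_, ?_⟩
    · rw [mem_Icc]; omega
    · omega
  -- assemble
  calc bandMomentN f c A₁ A₂ B H
      = ∑ a ∈ I, ∑ a' ∈ I.filter (fun a' => a' < a + H ∧ a < a' + H), g a a' := by
        simp only [bandMomentN, hI, hg]
    _ ≤ ∑ a ∈ I, (g a a + U a + ∑ a' ∈ I.filter (fun a' => a' < a ∧ a < a' + H), g a a') :=
        sum_le_sum hsplit
    _ = ∑ a ∈ I, g a a + ∑ a ∈ I, U a + ∑ a ∈ I, U a := by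
        rw [sum_add_distrib, sum_add_distrib, hswap]
    _ ≤ ∑ a ∈ I, g a a + 2 * ∑ a ∈ I, ∑ h ∈ Icc 1 (H - 1), g a (a + h) := by
        have := sum_le_sum fun a (_ : a ∈ I) => hUle a
        linarith

namespace IdeaR1

/-- VERBATIM from `SketchIdeator3.lean`: `λ` at an integer argument (`Int.toNat` convention). -/
def lam (n : ℤ) : ℝ := (ArithmeticFunction.liouville (Int.toNat n) : ℝ)

/-- VERBATIM from `SketchIdeator3.lean`: the pair sum `S_c(a,a';B)`. -/
def pairSum (c : ℤ) (a a' B : ℕ) : ℝ :=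
  ∑ b ∈ Icc 1 B, lam ((a : ℤ) * b + c) * lam ((a' : ℤ) * b + c)

/-- VERBATIM from `SketchIdeator3.lean` (card `slope-band-vdc`, transfer target `C⁺`). -/
def BandChowla : Prop :=
  ∀ c : ℤ, c ≠ 0 → ∀ δ : ℝ, 0 < δ → δ ≤ 1 / 12 → ∀ K : ℝ, 0 < K → ∃ x₀ : ℝ, ∀ x : ℝ, x₀ ≤ x →
    ∀ A : ℝ, x ^ δ ≤ A → A ≤ x ^ (1 / 3 + δ) →
      (∑ h ∈ Icc 1 ⌊Real.log x ^ K⌋₊, ∑ a ∈ Ioc ⌊A⌋₊ ⌊2 * A⌋₊,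
          (pairSum c a (a + h) ⌊x / A⌋₊) ^ 2) ≤ x ^ 2 * Real.log x / A

/-- The card's pair sum is this file's row correlation (definitionally). -/
theorem pairSum_eq (c : ℤ) (a a' B : ℕ) :
    pairSum c a a' B = rowCorr Negative.lam c B a a' := rfl

/-- **The card's first lemma `band_reduction : BandChowla → TableChowla`, PROVED** (band
domination `vdC_momentN` + the symmetric split + `diag ≤ rows·B² ≤ 2x²/A ≤ x² log x/A`). -/
theorem tableChowla_of_bandChowla (h : BandChowla) : LiouvilleShiftedTables.TableChowla := by
  refine tableChowla_of_bandBound (M := 3) (by norm_num) (s := 1) le_rfl fun c hc δ hδ hδ' K hK => ?_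
  obtain ⟨x₀, hx₀⟩ := h c hc δ hδ hδ' K hK
  refine ⟨max x₀ (Real.exp 2), fun x hx A hA hA' => ?_⟩
  have hx₀x : x₀ ≤ x := le_trans (le_max_left _ _) hx
  have hxe : Real.exp 2 ≤ x := le_trans (le_max_right _ _) hx
  have hxpos : 0 < x := (Real.exp_pos 2).trans_le hxe
  have hlog2 : 2 ≤ Real.log x := (Real.le_log_iff_exp_le hxpos).mpr hxe
  have hx1 : 1 ≤ x := by have := Real.add_one_le_exp (2 : ℝ); linarith
  have hAone : 1 ≤ A := le_trans (Real.one_le_rpow hx1 hδ.le) hA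
  have hApos : 0 < A := by linarith
  have key := hx₀ x hx₀x A hA hA'
  simp only [pairSum_eq] at key
  rw [sum_comm] at key
  -- key : Σ_a Σ_h S(a,a+h)² ≤ x² log x / A
  have hsplit := bandMomentN_le_diag_add_slopes (f := Negative.lam) (c := c) (A₁ := ⌊A⌋₊)
    (A₂ := ⌊2 * A⌋₊) (B := ⌊x / A⌋₊) (⌊Real.log x ^ K⌋₊ + 1)
  rw [Nat.add_sub_cancel] at hsplit
  -- diagonal ≤ rows B² ≤ 2x²/A ≤ x² log x / A
  have hdiag : ∑ a ∈ Ioc ⌊A⌋₊ ⌊2 * A⌋₊, rowCorr Negative.lam c ⌊x / A⌋₊ a a ^ 2 ≤ x ^ 2 * Real.log x / A := by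
    have hwin := rows_mul_cols_sq_le_window (x := x) (A := A) (δ := 0) hx1 le_rfl (by rw [Real.rpow_zero]; exact hAone)
    rw [Real.rpow_zero, div_one] at hwin
    calc ∑ a ∈ Ioc ⌊A⌋₊ ⌊2 * A⌋₊, rowCorr Negative.lam c ⌊x / A⌋₊ a a ^ 2
        ≤ ∑ _a ∈ Ioc ⌊A⌋₊ ⌊2 * A⌋₊, (⌊x / A⌋₊ : ℝ) ^ 2 := by
          refine sum_le_sum fun a _ => ?_
          have hb := abs_rowCorr_le (c := c) (B := ⌊x / A⌋₊) abs_lam_le_one a a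
          exact sq_le_sq' (by linarith [(abs_le.mp hb).1]) (abs_le.mp hb).2
      _ = ((⌊2 * A⌋₊ - ⌊A⌋₊ : ℕ) : ℝ) * (⌊x / A⌋₊ : ℝ) ^ 2 := by simp [Nat.card_Ioc]
      _ ≤ 2 * A * (x / A) ^ 2 := by
          have hcardR : ((⌊2 * A⌋₊ - ⌊A⌋₊ : ℕ) : ℝ) ≤ 2 * A := by
            rw [Nat.cast_sub (Nat.floor_le_floor (by linarith : A ≤ 2 * A))]
            have h1 : (⌊2 * A⌋₊ : ℝ) ≤ 2 * A := Nat.floor_le (by linarith)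
            have h2 : A - 1 < (⌊A⌋₊ : ℝ) := by have := Nat.lt_floor_add_one A; linarith
            linarith
          have hBle : (⌊x / A⌋₊ : ℝ) ≤ x / A := Nat.floor_le (by positivity)
          exact mul_le_mul hcardR (pow_le_pow_left₀ (by positivity) hBle 2) (by positivity) (by positivity)
      _ = 2 * x ^ 2 / A := by field_simp
      _ ≤ x ^ 2 * Real.log x / A := by
          apply div_le_div_of_nonneg_right _ hApos.le
          nlinarith [sq_nonneg x]
  calc bandMomentN Negative.lam c ⌊A⌋₊ ⌊2 * A⌋₊ ⌊x / A⌋₊ (⌊Real.log x ^ K⌋₊ + 1)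
      ≤ _ := hsplit
    _ ≤ x ^ 2 * Real.log x / A + 2 * (x ^ 2 * Real.log x / A) := by linarith
    _ = 3 * x ^ 2 * Real.log x / A := by ring

end IdeaR1


/-! ## (l) COLUMN BAND DOMINATION (the dual van der Corput, in the column variable — easier, and
new as a sufficient condition): `K·T ≤ (B + K − 1)·T_colband(K)` where `T_colband(K)` keeps only
COLUMN pairs `b, b'` at distance `< K`, i.e. squares of the SHORT sums
`G(b,b') = Σ_{a ∈ (A,2A]} λ(ab+c) λ(ab'+c)` — binary correlations of the two linear forms
`a ↦ b·a + c`, `a ↦ b'·a + c` over `a ∼ A` (length `x^δ … x^{5/12}`), for `≍ B·K` pairs of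
near-by columns. Hence `ColumnNearDiagonalChowla → TableChowla`: a `(log x)^{K−1}` mean-square
saving in these short two-form sums, on average over `b ≤ x/A` and `|b'−b| < (log x)^K`, proves
the crux — the Matomäki–Radziwiłł-shaped (short sums, big average) dual of the slope band. -/

/-- Column correlation `G(b,b') = Σ_{a ∈ (A₁,A₂]} f(ab+c) f(ab'+c)` (a SHORT sum over the rows). -/
def colCorr (f : ℕ → ℝ) (c : ℤ) (A₁ A₂ b b' : ℕ) : ℝ :=
  ∑ a ∈ Ioc A₁ A₂, f (Int.toNat ((a : ℤ) * b + c)) * f (Int.toNat ((a : ℤ) * b' + c))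

/-- COLUMN-BAND fourth moment: only column pairs at distance `< K` (diagonal included). -/
def colBandMomentN (f : ℕ → ℝ) (c : ℤ) (A₁ A₂ B K : ℕ) : ℝ :=
  ∑ b ∈ Icc 1 B, ∑ b' ∈ (Icc 1 B).filter (fun b' => b' < b + K ∧ b < b' + K), colCorr f c A₁ A₂ b b' ^ 2

/-- **COLUMN BAND DOMINATION**: `K · T ≤ (B + K − 1) · T_colband(K)` for every `K ≥ 1`. -/
theorem vdC_momentN_cols {K : ℕ} (hK : 1 ≤ K) :
    (K : ℝ) * momentN f c A₁ A₂ B ≤ ((B + K - 1 : ℕ) : ℝ) * colBandMomentN f c A₁ A₂ B K := by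
  set J : Finset ℕ := Icc 1 B with hJ
  set M : Finset ℕ := Icc 1 (B + K - 1) with hM
  have hJM : ∀ b ∈ J, ∀ m, b ≤ m → m < b + K → m ∈ M := by
    intro b hb m h1 h2
    rw [hJ, mem_Icc] at hb
    rw [hM, mem_Icc]
    omega
  have hMcard : (M.card : ℝ) = ((B + K - 1 : ℕ) : ℝ) := by
    rw [hM, Nat.card_Icc, Nat.add_sub_cancel]
  set e : ℕ → ℕ → ℝ := fun a b => f (Int.toNat ((a : ℤ) * b + c)) with he
  set w : ℕ → ℕ → ℝ := fun b b' =>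
    ((M.filter (fun m => (b ≤ m ∧ m < b + K) ∧ (b' ≤ m ∧ m < b' + K))).card : ℝ) with hw
  -- Step 1: K² T ≤ |M| Σ_{b,b'} w(b,b') G(b,b')²
  have step1 : (K : ℝ) ^ 2 * momentN f c A₁ A₂ B ≤
      (M.card : ℝ) * ∑ b ∈ J, ∑ b' ∈ J, w b b' * colCorr f c A₁ A₂ b b' ^ 2 := by
    have hpt : ∀ a a' : ℕ, (K : ℝ) ^ 2 * (∑ b ∈ J, e a b * e a' b) ^ 2 ≤
        (M.card : ℝ) * ∑ b ∈ J, ∑ b' ∈ J, (e a b * e a' b) * (e a b' * e a' b') * w b b' :=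
      fun a a' => vdC_pointwise (fun b => e a b * e a' b) hJM
    unfold momentN rowCorr
    rw [← hJ, mul_sum]
    simp_rw [mul_sum (s := Ioc A₁ A₂) (a := (K : ℝ) ^ 2)]
    calc ∑ a ∈ Ioc A₁ A₂, ∑ a' ∈ Ioc A₁ A₂, (K : ℝ) ^ 2 * (∑ b ∈ J, e a b * e a' b) ^ 2
        ≤ ∑ a ∈ Ioc A₁ A₂, ∑ a' ∈ Ioc A₁ A₂,
            (M.card : ℝ) * ∑ b ∈ J, ∑ b' ∈ J, (e a b * e a' b) * (e a b' * e a' b') * w b b' :=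
          sum_le_sum fun a _ => sum_le_sum fun a' _ => hpt a a'
      _ = (M.card : ℝ) * ∑ b ∈ J, ∑ b' ∈ J, w b b' * colCorr f c A₁ A₂ b b' ^ 2 := by
          rw [mul_sum]
          simp_rw [mul_sum (a := (M.card : ℝ))]
          -- bubble the column sums (over J) outside the row sums (over Ioc A₁ A₂)
          simp_rw [sum_comm (s := Ioc A₁ A₂) (t := J)]
          refine sum_congr rfl fun b _ => sum_congr rfl fun b' _ => ?_
          simp_rw [← mul_sum]
          congr 1
          unfold colCorr
          rw [sq, sum_mul_sum, mul_sum]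
          refine sum_congr rfl fun a _ => ?_
          rw [mul_sum]
          refine sum_congr rfl fun a' _ => ?_
          simp only [he]
          ring
  -- Step 2: Σ_{b,b'} w G² ≤ K · T_colband(K)
  have step2 : ∑ b ∈ J, ∑ b' ∈ J, w b b' * colCorr f c A₁ A₂ b b' ^ 2 ≤
      (K : ℝ) * colBandMomentN f c A₁ A₂ B K := by
    unfold colBandMomentN
    rw [← hJ, mul_sum]
    refine sum_le_sum fun b hb => ?_
    rw [mul_sum, ← sum_filter_add_sum_filter_not J (fun b' => b' < b + K ∧ b < b' + K)]
    have hzero : ∑ b' ∈ J.filter (fun b' => ¬ (b' < b + K ∧ b < b' + K)),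
        w b b' * colCorr f c A₁ A₂ b b' ^ 2 = 0 := by
      refine sum_eq_zero fun b' hb' => ?_
      have hna := (mem_filter.mp hb').2
      simp only [hw, card_overlap_eq_zero hna, Nat.cast_zero, zero_mul]
    rw [hzero, add_zero]
    refine sum_le_sum fun b' _ => ?_
    have hwle : w b b' ≤ K := by
      simp only [hw]
      exact_mod_cast card_overlap_le (hJM b hb)
    exact mul_le_mul_of_nonneg_right hwle (sq_nonneg _)
  have hKpos : (0 : ℝ) < K := by exact_mod_cast hK
  have hcomb : (K : ℝ) ^ 2 * momentN f c A₁ A₂ B ≤ (K : ℝ) * (((B + K - 1 : ℕ) : ℝ) * colBandMomentN f c A₁ A₂ B K) := by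
    calc (K : ℝ) ^ 2 * momentN f c A₁ A₂ B
        ≤ (M.card : ℝ) * ∑ b ∈ J, ∑ b' ∈ J, w b b' * colCorr f c A₁ A₂ b b' ^ 2 := step1
      _ ≤ (M.card : ℝ) * ((K : ℝ) * colBandMomentN f c A₁ A₂ B K) :=
          mul_le_mul_of_nonneg_left step2 (Nat.cast_nonneg _)
      _ = (K : ℝ) * (((B + K - 1 : ℕ) : ℝ) * colBandMomentN f c A₁ A₂ B K) := by rw [hMcard]; ring
  rw [sq, mul_assoc] at hcomb
  exact le_of_mul_le_mul_left hcomb hKpos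

/-- COLUMN NEAR-DIAGONAL CHOWLA (short two-form sums, band of near-by columns, budget
`M·x·A·log x` — dual to `NearDiagonalChowla`'s `x² log x / A = x·B·log x`). -/
def ColumnNearDiagonalChowla : Prop :=
  ∀ c : ℤ, c ≠ 0 → ∀ δ : ℝ, 0 < δ → δ ≤ 1 / 12 → ∀ K : ℝ, 0 < K → ∃ x₀ : ℝ, ∀ x : ℝ, x₀ ≤ x →
    ∀ A : ℝ, x ^ δ ≤ A → A ≤ x ^ (1 / 3 + δ) →
      colBandMomentN lam c ⌊A⌋₊ ⌊2 * A⌋₊ ⌊x / A⌋₊ ⌊Real.log x ^ K⌋₊ ≤ x * A * Real.log x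

/-- **COLUMN BAND REDUCTION**: `ColumnNearDiagonalChowla → TableChowla` (take `K = C + 2`,
`Kn = ⌊(log x)^{C+2}⌋ ≤ B/2`; column band domination gives `T ≤ ((B + Kn)/Kn)·x A log x ≤
4x²/(log x)^{C+1}`). -/
theorem tableChowla_of_columnNearDiagonal (h : ColumnNearDiagonalChowla) :
    LiouvilleShiftedTables.TableChowla := by
  rw [tableChowla_iff]
  intro c hc δ hδ hδ' C hC
  obtain ⟨x₀, hx₀⟩ := h c hc δ hδ hδ' (C + 2) (by linarith)
  obtain ⟨X₁, hX₁⟩ := eventually_log_rpow_le hδ (C + 2)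
  refine ⟨max (max x₀ 4096) (max X₁ (Real.exp 8)), fun x hx A hA hA' => ?_⟩
  have hx₀x : x₀ ≤ x := le_trans (le_trans (le_max_left _ _) (le_max_left _ _)) hx
  have hx4096 : (4096 : ℝ) ≤ x := le_trans (le_trans (le_max_right _ _) (le_max_left _ _)) hx
  have hxX₁ : X₁ ≤ x := le_trans (le_trans (le_max_left _ _) (le_max_right _ _)) hx
  have hxe : Real.exp 8 ≤ x := le_trans (le_trans (le_max_right _ _) (le_max_right _ _)) hx
  have hx1 : (1 : ℝ) ≤ x := by linarith
  have hxpos : 0 < x := by linarith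
  have hlog8 : 8 ≤ Real.log x := (Real.le_log_iff_exp_le hxpos).mpr hxe
  have hlogpos : 0 < Real.log x := by linarith
  obtain ⟨h4, _⟩ := hX₁ x hxX₁
  have hAone : 1 ≤ A := le_trans (Real.one_le_rpow hx1 hδ.le) hA
  have hApos : 0 < A := by linarith
  -- Kr := (log x)^(C+2): 6 ≤ Kr ≤ x^δ/4 ≤ A/4, Kn := ⌊Kr⌋, Kn ≥ Kr/2
  set Kr : ℝ := Real.log x ^ (C + 2) with hKr
  have hKr8 : 8 ≤ Kr := by
    calc (8 : ℝ) ≤ Real.log x := hlog8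
      _ = Real.log x ^ (1 : ℝ) := (Real.rpow_one _).symm
      _ ≤ Kr := by rw [hKr]; exact Real.rpow_le_rpow_of_exponent_le (by linarith) (by linarith)
  set Kn : ℕ := ⌊Kr⌋₊ with hKndef
  have hKn1 : 1 ≤ Kn := by rw [hKndef, Nat.one_le_floor_iff]; linarith
  have hKnle : (Kn : ℝ) ≤ Kr := Nat.floor_le (by linarith)
  have hKnge : Kr / 2 ≤ Kn := by
    have := Nat.lt_floor_add_one Kr; rw [← hKndef] at this; linarith
  have hKnpos : (0 : ℝ) < Kn := by exact_mod_cast hKn1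
  -- B = ⌊x/A⌋ ≥ x^{7/12} - 1 ≥ ... we only need Kn ≤ B: Kr ≤ A/4?? no — need Kr ≤ B. B ≥ x/A - 1 ≥ x^{7/12} - 1.
  set Bn : ℕ := ⌊x / A⌋₊ with hBn
  have hBge : x / A - 1 < Bn := by have := Nat.lt_floor_add_one (x / A); rw [← hBn] at this; linarith
  have hxA : x ^ ((7 : ℝ) / 12) ≤ x / A := by
    rw [le_div_iff₀ hApos]
    calc x ^ ((7 : ℝ) / 12) * A ≤ x ^ ((7 : ℝ) / 12) * x ^ (1 / 3 + δ) :=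
          mul_le_mul_of_nonneg_left hA' (by positivity)
      _ = x ^ ((7 : ℝ) / 12 + (1 / 3 + δ)) := by rw [← Real.rpow_add hxpos]
      _ ≤ x ^ (1 : ℝ) := Real.rpow_le_rpow_of_exponent_le hx1 (by linarith)
      _ = x := Real.rpow_one x
  -- Kr ≤ x^δ/4 ≤ x^{7/12}/4 (δ ≤ 1/12 ≤ 7/12) and x^{7/12} ≥ 4096^{7/12} = 128 ⇒ Kr ≤ x^{7/12} - 1 - ... : Kn ≤ Kr ≤ (x/A) /4 ≤ Bn
  have hx712 : x ^ δ ≤ x ^ ((7 : ℝ) / 12) := Real.rpow_le_rpow_of_exponent_le hx1 (by linarith)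
  have h128 : (128 : ℝ) ≤ x ^ ((7 : ℝ) / 12) := by
    have e : ((2 : ℝ) ^ (12 : ℕ)) ^ ((7 : ℝ) / 12) = 2 ^ (7 : ℕ) := by
      rw [← Real.rpow_natCast (2 : ℝ) 12, ← Real.rpow_mul (by norm_num)]
      norm_num
    calc (128 : ℝ) = ((2 : ℝ) ^ (12 : ℕ)) ^ ((7 : ℝ) / 12) := by rw [e]; norm_num
      _ ≤ x ^ ((7 : ℝ) / 12) := Real.rpow_le_rpow (by norm_num) (by norm_num; linarith) (by norm_num)
  have hKrB : Kr ≤ (Bn : ℝ) / 2 := by nlinarith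
  have hband := hx₀ x hx₀x A hA hA'
  rw [← hKr, ← hKndef, ← hBn] at hband
  have hvdc := vdC_momentN_cols (f := lam) (c := c) (A₁ := ⌊A⌋₊) (A₂ := ⌊2 * A⌋₊) (B := Bn) hKn1
  have hcols : ((Bn + Kn - 1 : ℕ) : ℝ) ≤ 2 * Bn := by
    have h2 : ((Bn + Kn - 1 : ℕ) : ℝ) ≤ ((Bn + Kn : ℕ) : ℝ) := by exact_mod_cast Nat.sub_le _ _
    push_cast at h2
    linarith
  have hbandnn : 0 ≤ colBandMomentN lam c ⌊A⌋₊ ⌊2 * A⌋₊ Bn Kn :=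
    sum_nonneg fun _ _ => sum_nonneg fun _ _ => sq_nonneg _
  have hBle : (Bn : ℝ) ≤ x / A := Nat.floor_le (by positivity)
  -- Kn T ≤ 2 Bn · x A log x ≤ 2 (x/A) x A log x = 2 x² log x
  have hKT : (Kn : ℝ) * momentN lam c ⌊A⌋₊ ⌊2 * A⌋₊ Bn ≤ 2 * x ^ 2 * Real.log x := by
    calc (Kn : ℝ) * momentN lam c ⌊A⌋₊ ⌊2 * A⌋₊ Bn
        ≤ ((Bn + Kn - 1 : ℕ) : ℝ) * colBandMomentN lam c ⌊A⌋₊ ⌊2 * A⌋₊ Bn Kn := hvdc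
      _ ≤ (2 * Bn) * (x * A * Real.log x) := mul_le_mul hcols hband hbandnn (by positivity)
      _ ≤ (2 * (x / A)) * (x * A * Real.log x) :=
          mul_le_mul_of_nonneg_right (by linarith) (by positivity)
      _ = 2 * x ^ 2 * Real.log x := by field_simp
  -- T ≤ 2x² log x / Kn ≤ 4 x² log x / Kr = 4x²/(log x)^{C+1} ≤ x²/(log x)^C  (log x ≥ 8 ≥ 4)
  have hsplit : Kr = Real.log x ^ C * Real.log x ^ 2 := by
    rw [hKr, Real.rpow_add hlogpos, Real.rpow_two]
  show momentN lam c ⌊A⌋₊ ⌊2 * A⌋₊ ⌊x / A⌋₊ ≤ x ^ 2 / Real.log x ^ C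
  rw [← hBn]
  have hLpos : 0 < Real.log x ^ C := Real.rpow_pos_of_pos hlogpos C
  rw [le_div_iff₀ hLpos]
  have hT0 : 0 ≤ momentN lam c ⌊A⌋₊ ⌊2 * A⌋₊ Bn := momentN_nonneg
  have h1 : Kr * momentN lam c ⌊A⌋₊ ⌊2 * A⌋₊ Bn ≤ 4 * x ^ 2 * Real.log x := by
    nlinarith [mul_le_mul_of_nonneg_right hKnge hT0]
  rw [hsplit] at h1
  have hl2 : 0 < Real.log x ^ 2 := by positivity
  have h2 : momentN lam c ⌊A⌋₊ ⌊2 * A⌋₊ Bn * Real.log x ^ C * Real.log x ^ 2 ≤ x ^ 2 * Real.log x ^ 2 := by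
    have hx2l : (0 : ℝ) ≤ x ^ 2 * Real.log x := by positivity
    calc momentN lam c ⌊A⌋₊ ⌊2 * A⌋₊ Bn * Real.log x ^ C * Real.log x ^ 2
        = Real.log x ^ C * Real.log x ^ 2 * momentN lam c ⌊A⌋₊ ⌊2 * A⌋₊ Bn := by ring
      _ ≤ 4 * x ^ 2 * Real.log x := h1
      _ = 4 * (x ^ 2 * Real.log x) := by ring
      _ ≤ Real.log x * (x ^ 2 * Real.log x) := mul_le_mul_of_nonneg_right (by linarith) hx2l
      _ = x ^ 2 * Real.log x ^ 2 := by ring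
  exact le_of_mul_le_mul_right h2 hl2


/-! ## (m) CORNER (LOCAL BOX) DOMINATION — double van der Corput, and the REPAIRED first lemma of
card `corner-local-box`: `T ≤ (N+H−1)(B+K−1)·[2NB/H + 2NB/K + 4·max_{1≤h<H, 1≤k<K} |𝒞(h,k)|]`
with the restricted corner sums `𝒞(h,k) = Σ_{a,a+h ∈ rows} Σ_{b,b+k ∈ cols} e(a,b)e(a+h,b)e(a,b+k)e(a+h,b+k)`
(both gaps POSITIVE — the axes are the two diagonal terms `2NB/H`, `2NB/K`). -/

section cornerTools

variable {I M : Finset ℕ} {H : ℕ}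

/-- Exact overlap count for two windows inside `M`: `#([a,a+H) ∩ [a+h,a+h+H) ∩ M) = H − h`. -/
theorem card_overlap_eq {a h : ℕ} (haM : ∀ m, a ≤ m → m < a + H → m ∈ M) (hh : h < H) :
    (M.filter (fun m => (a ≤ m ∧ m < a + H) ∧ (a + h ≤ m ∧ m < a + h + H))).card = H - h := by
  have : M.filter (fun m => (a ≤ m ∧ m < a + H) ∧ (a + h ≤ m ∧ m < a + h + H)) = Finset.Ico (a + h) (a + H) := by
    ext m
    simp only [mem_filter, Finset.mem_Ico]
    constructor
    · rintro ⟨_, ⟨_, h2⟩, h3, _⟩; exact ⟨h3, h2⟩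
    · rintro ⟨h1, h2⟩; exact ⟨haM m (by omega) h2, ⟨by omega, h2⟩, h1, by omega⟩
  rw [this, Nat.card_Ico]
  omega

/-- At most `2H − 1` (so `≤ 2H`) members of any set lie in the band around `a`. -/
theorem card_band_le (S : Finset ℕ) (a : ℕ) :
    (S.filter (fun a' => a' < a + H ∧ a < a' + H)).card ≤ 2 * H := by
  calc (S.filter (fun a' => a' < a + H ∧ a < a' + H)).card
      ≤ (Finset.Ico (a + 1 - H) (a + H)).card := by
        apply card_le_card
        intro a' ha'
        simp only [mem_filter] at ha'
        rw [Finset.mem_Ico]; omega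
    _ ≤ 2 * H := by rw [Nat.card_Ico]; omega

/-- Sum of overlap weights over one index is `≤ 2H²`. -/
theorem sum_overlap_le (S : Finset ℕ) (a : ℕ) (haM : ∀ m, a ≤ m → m < a + H → m ∈ M) :
    ∑ a' ∈ S, ((M.filter (fun m => (a ≤ m ∧ m < a + H) ∧ (a' ≤ m ∧ m < a' + H))).card : ℝ) ≤
      2 * (H : ℝ) ^ 2 := by
  rw [← sum_filter_add_sum_filter_not S (fun a' => a' < a + H ∧ a < a' + H)]
  have hzero : ∑ a' ∈ S.filter (fun a' => ¬ (a' < a + H ∧ a < a' + H)),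
      ((M.filter (fun m => (a ≤ m ∧ m < a + H) ∧ (a' ≤ m ∧ m < a' + H))).card : ℝ) = 0 := by
    refine sum_eq_zero fun a' ha' => ?_
    rw [card_overlap_eq_zero (mem_filter.mp ha').2, Nat.cast_zero]
  rw [hzero, add_zero]
  calc ∑ a' ∈ S.filter (fun a' => a' < a + H ∧ a < a' + H),
        ((M.filter (fun m => (a ≤ m ∧ m < a + H) ∧ (a' ≤ m ∧ m < a' + H))).card : ℝ)
      ≤ ∑ _a' ∈ S.filter (fun a' => a' < a + H ∧ a < a' + H), (H : ℝ) := by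
        refine sum_le_sum fun a' _ => ?_
        exact_mod_cast card_overlap_le haM
    _ = ((S.filter (fun a' => a' < a + H ∧ a < a' + H)).card : ℝ) * H := by rw [sum_const, nsmul_eq_mul]
    _ ≤ (2 * H) * H := by
        apply mul_le_mul_of_nonneg_right _ (Nat.cast_nonneg _)
        exact_mod_cast card_band_le S a
    _ = 2 * (H : ℝ) ^ 2 := by ring

/-- Regrouping the STRICT UPPER pairs of `I × I` by the gap `h = a' − a ∈ [1, D)`, for any `D`
exceeding the diameter. -/
theorem sum_upper_pairs_eq_sum_gaps (I : Finset ℕ) (F : ℕ → ℕ → ℝ) (D : ℕ)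
    (hD : ∀ a ∈ I, ∀ a' ∈ I, a' < a + D) :
    ∑ a ∈ I, ∑ a' ∈ I.filter (fun a' => a < a'), F a a' =
      ∑ a ∈ I, ∑ h ∈ (Finset.Ico 1 D).filter (fun h => a + h ∈ I), F a (a + h) := by
  refine sum_congr rfl fun a ha => ?_
  have hinj : Set.InjOn (fun h => a + h) ((Finset.Ico 1 D).filter (fun h => a + h ∈ I) : Finset ℕ) :=
    fun h _ h' _ hh => by simpa using hh
  rw [← sum_image hinj]
  refine sum_congr ?_ fun _ _ => rfl
  ext a'
  simp only [mem_filter, mem_image, Finset.mem_Ico]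
  constructor
  · rintro ⟨ha', hlt⟩
    exact ⟨a' - a, ⟨⟨by omega, by have := hD a ha a' ha'; omega⟩, by rwa [show a + (a' - a) = a' by omega]⟩, by omega⟩
  · rintro ⟨h, ⟨⟨h1, _⟩, hmem⟩, rfl⟩
    exact ⟨hmem, by omega⟩

/-- Symmetry: the strict LOWER pairs contribute the transpose of the strict upper ones. -/
theorem sum_lower_pairs_eq (I : Finset ℕ) (F : ℕ → ℕ → ℝ) :
    ∑ a ∈ I, ∑ a' ∈ I.filter (fun a' => a' < a), F a a' = ∑ a ∈ I, ∑ a' ∈ I.filter (fun a' => a < a'), F a' a := by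
  simp only [sum_filter]
  rw [sum_comm]

/-- Splitting `I × I` into diagonal, strict upper and strict lower pairs. -/
theorem sum_pairs_split (I : Finset ℕ) (F : ℕ → ℕ → ℝ) :
    ∑ a ∈ I, ∑ a' ∈ I, F a a' = ∑ a ∈ I, F a a + ∑ a ∈ I, ∑ a' ∈ I.filter (fun a' => a < a'), F a a' +
      ∑ a ∈ I, ∑ a' ∈ I.filter (fun a' => a' < a), F a a' := by
  rw [← sum_add_distrib, ← sum_add_distrib]
  refine sum_congr rfl fun a ha => ?_
  rw [sum_filter, sum_filter]
  have hdiag : F a a = ∑ a' ∈ I, if a' = a then F a a' else 0 := by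
    rw [Finset.sum_ite_eq', if_pos ha]
  rw [hdiag, ← sum_add_distrib, ← sum_add_distrib]
  refine sum_congr rfl fun a' _ => ?_
  rcases lt_trichotomy a a' with hlt | heq | hgt
  · rw [if_neg (by omega), if_pos hlt, if_neg (by omega)]; ring
  · subst heq; simp
  · rw [if_neg (by omega), if_neg (by omega), if_pos hgt]; ring

end cornerTools


section cornerTools2

variable {I M : Finset ℕ} {H : ℕ}

/-- The overlap weight as a function. -/
def overlapW (M : Finset ℕ) (H a a' : ℕ) : ℝ :=
  ((M.filter (fun m => (a ≤ m ∧ m < a + H) ∧ (a' ≤ m ∧ m < a' + H))).card : ℝ)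

/-- The overlap weight is symmetric. -/
theorem overlapW_symm (M : Finset ℕ) (H a a' : ℕ) : overlapW M H a a' = overlapW M H a' a := by
  unfold overlapW
  rw [Finset.filter_congr (fun m _ => and_comm)]

/-- The overlap weight is non-negative. -/
theorem overlapW_nonneg (M : Finset ℕ) (H a a' : ℕ) : 0 ≤ overlapW M H a a' := Nat.cast_nonneg _

/-- Symmetric collapse: for a symmetric `G`, `Σ_{a,a'∈I} G = Σ_a G a a + 2·Σ_a Σ_{a'>a} G a a'`. -/
theorem sum_pairs_symm (I : Finset ℕ) (G : ℕ → ℕ → ℝ) (hG : ∀ a a', G a a' = G a' a) :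
    ∑ a ∈ I, ∑ a' ∈ I, G a a' = ∑ a ∈ I, G a a + 2 * ∑ a ∈ I, ∑ a' ∈ I.filter (fun a' => a < a'), G a a' := by
  rw [sum_pairs_split, sum_lower_pairs_eq]
  have : ∑ a ∈ I, ∑ a' ∈ I.filter (fun a' => a < a'), G a' a = ∑ a ∈ I, ∑ a' ∈ I.filter (fun a' => a < a'), G a a' :=
    sum_congr rfl fun a _ => sum_congr rfl fun a' _ => (hG a a').symm
  rw [this]
  ring

/-- Strict upper pairs whose far terms vanish beyond the window, regrouped by the gap. -/
theorem sum_upper_window (I : Finset ℕ) (F : ℕ → ℕ → ℝ) (Hw : ℕ)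
    (hvan : ∀ a ∈ I, ∀ a' ∈ I, a + Hw ≤ a' → F a a' = 0) :
    ∑ a ∈ I, ∑ a' ∈ I.filter (fun a' => a < a'), F a a' =
      ∑ a ∈ I, ∑ h ∈ (Finset.Ico 1 Hw).filter (fun h => a + h ∈ I), F a (a + h) := by
  refine sum_congr rfl fun a ha => ?_
  -- first restrict to a' < a + Hw (the rest vanishes)
  have hrestrict : ∑ a' ∈ I.filter (fun a' => a < a'), F a a' =
      ∑ a' ∈ I.filter (fun a' => a < a' ∧ a' < a + Hw), F a a' := by
    rw [sum_filter, sum_filter]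
    refine sum_congr rfl fun a' ha' => ?_
    by_cases h1 : a < a'
    · by_cases h2 : a' < a + Hw
      · rw [if_pos h1, if_pos ⟨h1, h2⟩]
      · rw [if_pos h1, if_neg (fun h => h2 h.2), hvan a ha a' ha' (by omega)]
    · rw [if_neg h1, if_neg (fun h => h1 h.1)]
  rw [hrestrict]
  have hinj : Set.InjOn (fun h => a + h) ((Finset.Ico 1 Hw).filter (fun h => a + h ∈ I) : Finset ℕ) :=
    fun h _ h' _ hh => by simpa using hh
  rw [← sum_image hinj]
  refine sum_congr ?_ fun _ _ => rfl
  ext a'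
  simp only [mem_filter, mem_image, Finset.mem_Ico]
  constructor
  · rintro ⟨ha', hlt, hlt2⟩
    exact ⟨a' - a, ⟨⟨by omega, by omega⟩, by rwa [show a + (a' - a) = a' by omega]⟩, by omega⟩
  · rintro ⟨h, ⟨⟨h1, h2⟩, hmem⟩, rfl⟩
    exact ⟨hmem, by omega, by omega⟩

/-- Commuting an index sum with a filtered gap sum. -/
theorem sum_filter_comm (I T : Finset ℕ) (X : ℕ → ℕ → ℝ) :
    ∑ a ∈ I, ∑ h ∈ T.filter (fun h => a + h ∈ I), X a h = ∑ h ∈ T, ∑ a ∈ I.filter (fun a => a + h ∈ I), X a h := by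
  simp only [sum_filter]
  rw [sum_comm]

end cornerTools2

/-- The 4-point (box) product of table entries at rows `a, a'` and columns `b, b'`. -/
def boxProd (f : ℕ → ℝ) (c : ℤ) (a a' b b' : ℕ) : ℝ :=
  f (Int.toNat ((a : ℤ) * b + c)) * f (Int.toNat ((a' : ℤ) * b + c)) *
    (f (Int.toNat ((a : ℤ) * b' + c)) * f (Int.toNat ((a' : ℤ) * b' + c)))

/-- RESTRICTED CORNER SUM at POSITIVE gaps `(h,k)`: all four corners inside the table. -/
def cornerRes (f : ℕ → ℝ) (c : ℤ) (A₁ A₂ B h k : ℕ) : ℝ :=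
  ∑ a ∈ (Ioc A₁ A₂).filter (fun a => a + h ∈ Ioc A₁ A₂),
    ∑ b ∈ (Icc 1 B).filter (fun b => b + k ∈ Icc 1 B), boxProd f c a (a + h) b (b + k)

/-- The box product is symmetric in the two rows. -/
theorem boxProd_symm_rows (a a' b b' : ℕ) : boxProd f c a a' b b' = boxProd f c a' a b b' := by
  unfold boxProd; ring

/-- The box product is symmetric in the two columns. -/
theorem boxProd_symm_cols (a a' b b' : ℕ) : boxProd f c a a' b b' = boxProd f c a a' b' b := by
  unfold boxProd; ring

/-- `|boxProd| ≤ 1` for `|f| ≤ 1`. -/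
theorem abs_boxProd_le (hf : ∀ n, |f n| ≤ 1) (a a' b b' : ℕ) : |boxProd f c a a' b b'| ≤ 1 := by
  unfold boxProd
  rw [abs_mul, abs_mul, abs_mul]
  have h1 := hf (Int.toNat ((a : ℤ) * b + c)); have h2 := hf (Int.toNat ((a' : ℤ) * b + c))
  have h3 := hf (Int.toNat ((a : ℤ) * b' + c)); have h4 := hf (Int.toNat ((a' : ℤ) * b' + c))
  calc |f (Int.toNat ((a : ℤ) * b + c))| * |f (Int.toNat ((a' : ℤ) * b + c))| *
        (|f (Int.toNat ((a : ℤ) * b' + c))| * |f (Int.toNat ((a' : ℤ) * b' + c))|) ≤ 1 * 1 * (1 * 1) := by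
        gcongr
    _ = 1 := by ring

/-- **CORNER (LOCAL BOX) DOMINATION.** For `|f| ≤ 1`, windows `H, K ≥ 1` and a bound `Mx` on the
restricted corner sums at all positive gaps `h < H`, `k < K`:
`H²K²·T ≤ (A₂+H−1−A₁)(B+K−1)·(2·N·B·H·K² + 4·N·B·H²·K + 4·H²·K²·Mx)` (`N` = number of rows). -/
theorem corner_domination (hf : ∀ n, |f n| ≤ 1) {H K : ℕ} (hH : 1 ≤ H) (hK : 1 ≤ K) {Mx : ℝ} (hMx0 : 0 ≤ Mx)
    (hMx : ∀ h ∈ Finset.Ico 1 H, ∀ k ∈ Finset.Ico 1 K, |cornerRes f c A₁ A₂ B h k| ≤ Mx) :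
    ((H : ℝ) ^ 2 * (K : ℝ) ^ 2) * momentN f c A₁ A₂ B ≤
      ((A₂ + H - 1 - A₁ : ℕ) : ℝ) * ((B + K - 1 : ℕ) : ℝ) *
        (2 * (Ioc A₁ A₂).card * B * H * (K : ℝ) ^ 2 + 4 * (Ioc A₁ A₂).card * B * (H : ℝ) ^ 2 * K +
          4 * (H : ℝ) ^ 2 * (K : ℝ) ^ 2 * Mx) := by
  set I : Finset ℕ := Ioc A₁ A₂ with hI
  set J : Finset ℕ := Icc 1 B with hJ
  set M : Finset ℕ := Icc (A₁ + 1) (A₂ + H - 1) with hM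
  set M' : Finset ℕ := Icc 1 (B + K - 1) with hM'
  have hIM : ∀ a ∈ I, ∀ m, a ≤ m → m < a + H → m ∈ M := by
    intro a ha m h1 h2; rw [hI, mem_Ioc] at ha; rw [hM, mem_Icc]; omega
  have hJM : ∀ b ∈ J, ∀ m, b ≤ m → m < b + K → m ∈ M' := by
    intro b hb m h1 h2; rw [hJ, mem_Icc] at hb; rw [hM', mem_Icc]; omega
  have hMcard : (M.card : ℝ) = ((A₂ + H - 1 - A₁ : ℕ) : ℝ) := by rw [hM, Nat.card_Icc]; congr 1; omega
  have hM'card : (M'.card : ℝ) = ((B + K - 1 : ℕ) : ℝ) := by rw [hM', Nat.card_Icc, Nat.add_sub_cancel]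
  have hJcard : (J.card : ℝ) = B := by rw [hJ, Nat.card_Icc, Nat.add_sub_cancel]
  set e : ℕ → ℕ → ℝ := fun a b => f (Int.toNat ((a : ℤ) * b + c)) with he
  have habs_e : ∀ a b, |e a b| ≤ 1 := fun a b => hf _
  -- inner (column) weighted sums
  set inner : ℕ → ℕ → ℝ := fun a a' => ∑ b ∈ J, ∑ b' ∈ J, overlapW M' K b b' * boxProd f c a a' b b' with hinner
  -- Step 1 (rows): H² T ≤ |M| Σ w S²
  have step1 : (H : ℝ) ^ 2 * momentN f c A₁ A₂ B ≤
      (M.card : ℝ) * ∑ a ∈ I, ∑ a' ∈ I, overlapW M H a a' * rowCorr f c B a a' ^ 2 := by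
    have hpt : ∀ b b' : ℕ, (H : ℝ) ^ 2 * (∑ a ∈ I, e a b * e a b') ^ 2 ≤
        (M.card : ℝ) * ∑ a ∈ I, ∑ a' ∈ I, (e a b * e a b') * (e a' b * e a' b') * overlapW M H a a' :=
      fun b b' => vdC_pointwise (fun a => e a b * e a b') hIM
    have hT : momentN f c A₁ A₂ B = ∑ b ∈ Icc 1 B, ∑ b' ∈ Icc 1 B, (∑ a ∈ I, e a b * e a b') ^ 2 := by
      rw [momentN_eq_colMoment]
    rw [hT, mul_sum]
    simp_rw [mul_sum (s := Icc 1 B) (a := (H : ℝ) ^ 2)]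
    calc ∑ b ∈ Icc 1 B, ∑ b' ∈ Icc 1 B, (H : ℝ) ^ 2 * (∑ a ∈ I, e a b * e a b') ^ 2
        ≤ ∑ b ∈ Icc 1 B, ∑ b' ∈ Icc 1 B,
            (M.card : ℝ) * ∑ a ∈ I, ∑ a' ∈ I, (e a b * e a b') * (e a' b * e a' b') * overlapW M H a a' :=
          sum_le_sum fun b _ => sum_le_sum fun b' _ => hpt b b'
      _ = (M.card : ℝ) * ∑ a ∈ I, ∑ a' ∈ I, overlapW M H a a' * rowCorr f c B a a' ^ 2 := by
          rw [mul_sum]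
          simp_rw [mul_sum (a := (M.card : ℝ))]
          simp_rw [sum_comm (s := Icc 1 B) (t := I)]
          refine sum_congr rfl fun a _ => sum_congr rfl fun a' _ => ?_
          simp_rw [← mul_sum]
          congr 1
          unfold rowCorr
          rw [sq, sum_mul_sum, mul_sum]
          refine sum_congr rfl fun b _ => ?_
          rw [mul_sum]
          refine sum_congr rfl fun b' _ => ?_
          simp only [he]
          ring
  -- Step 2 (columns): K² S(a,a')² ≤ |M'| inner(a,a')
  have step2 : ∀ a a' : ℕ, (K : ℝ) ^ 2 * rowCorr f c B a a' ^ 2 ≤ (M'.card : ℝ) * inner a a' := by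
    intro a a'
    have hv := vdC_pointwise (I := J) (M := M') (H := K) (fun b => e a b * e a' b) hJM
    have hS : rowCorr f c B a a' = ∑ b ∈ J, e a b * e a' b := by unfold rowCorr; rfl
    rw [hS]
    refine le_trans hv (le_of_eq ?_)
    simp only [hinner]
    congr 1
    refine sum_congr rfl fun b _ => sum_congr rfl fun b' _ => ?_
    simp only [overlapW, boxProd, he]
    ring
  -- Combine: H²K² T ≤ |M||M'| Q
  set Q : ℝ := ∑ a ∈ I, ∑ a' ∈ I, overlapW M H a a' * inner a a' with hQ
  have e1 : (K : ℝ) ^ 2 * ((M.card : ℝ) * ∑ a ∈ I, ∑ a' ∈ I, overlapW M H a a' * rowCorr f c B a a' ^ 2) =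
      (M.card : ℝ) * ∑ a ∈ I, ∑ a' ∈ I, overlapW M H a a' * ((K : ℝ) ^ 2 * rowCorr f c B a a' ^ 2) := by
    rw [mul_left_comm, Finset.mul_sum]
    congr 1
    refine sum_congr rfl fun a _ => ?_
    rw [Finset.mul_sum]
    refine sum_congr rfl fun a' _ => ?_
    ring
  have e2 : (M.card : ℝ) * ∑ a ∈ I, ∑ a' ∈ I, overlapW M H a a' * ((M'.card : ℝ) * inner a a') =
      (M.card : ℝ) * (M'.card : ℝ) * Q := by
    have hin : ∑ a ∈ I, ∑ a' ∈ I, overlapW M H a a' * ((M'.card : ℝ) * inner a a') =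
        (M'.card : ℝ) * ∑ a ∈ I, ∑ a' ∈ I, overlapW M H a a' * inner a a' := by
      rw [Finset.mul_sum]
      refine sum_congr rfl fun a _ => ?_
      rw [Finset.mul_sum]
      refine sum_congr rfl fun a' _ => ?_
      ring
    rw [hin, hQ]
    ring
  have hcomb : ((H : ℝ) ^ 2 * (K : ℝ) ^ 2) * momentN f c A₁ A₂ B ≤ (M.card : ℝ) * (M'.card : ℝ) * Q := by
    calc ((H : ℝ) ^ 2 * (K : ℝ) ^ 2) * momentN f c A₁ A₂ B = (K : ℝ) ^ 2 * ((H : ℝ) ^ 2 * momentN f c A₁ A₂ B) := by ring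
      _ ≤ (K : ℝ) ^ 2 * ((M.card : ℝ) * ∑ a ∈ I, ∑ a' ∈ I, overlapW M H a a' * rowCorr f c B a a' ^ 2) :=
          mul_le_mul_of_nonneg_left step1 (by positivity)
      _ = (M.card : ℝ) * ∑ a ∈ I, ∑ a' ∈ I, overlapW M H a a' * ((K : ℝ) ^ 2 * rowCorr f c B a a' ^ 2) := e1
      _ ≤ (M.card : ℝ) * ∑ a ∈ I, ∑ a' ∈ I, overlapW M H a a' * ((M'.card : ℝ) * inner a a') := by
          apply mul_le_mul_of_nonneg_left _ (Nat.cast_nonneg _)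
          exact sum_le_sum fun a _ => sum_le_sum fun a' _ =>
            mul_le_mul_of_nonneg_left (step2 a a') (overlapW_nonneg _ _ _ _)
      _ = (M.card : ℝ) * (M'.card : ℝ) * Q := e2
  -- Symmetric collapse in the rows: Q = D_a + 2 U
  have hGsymm : ∀ a a', overlapW M H a a' * inner a a' = overlapW M H a' a * inner a' a := by
    intro a a'
    rw [overlapW_symm]
    simp only [hinner]
    congr 1
    exact sum_congr rfl fun b _ => sum_congr rfl fun b' _ => by rw [boxProd_symm_rows]
  have hQsplit := sum_pairs_symm I (fun a a' => overlapW M H a a' * inner a a') hGsymm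
  -- Symmetric collapse in the columns: inner a a' = D_b a a' + 2 U_b a a'
  have hinner_symm : ∀ a a' b b', overlapW M' K b b' * boxProd f c a a' b b' = overlapW M' K b' b * boxProd f c a a' b' b := by
    intro a a' b b'; rw [overlapW_symm, boxProd_symm_cols]
  have hinner_split : ∀ a a', inner a a' = ∑ b ∈ J, overlapW M' K b b * boxProd f c a a' b b +
      2 * ∑ b ∈ J, ∑ b' ∈ J.filter (fun b' => b < b'), overlapW M' K b b' * boxProd f c a a' b b' := by
    intro a a'
    simp only [hinner]
    exact sum_pairs_symm J (fun b b' => overlapW M' K b b' * boxProd f c a a' b b') (hinner_symm a a')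
  -- (i) the row-diagonal part
  have hDa : |∑ a ∈ I, overlapW M H a a * inner a a| ≤ 2 * (I.card : ℝ) * B * H * (K : ℝ) ^ 2 := by
    calc |∑ a ∈ I, overlapW M H a a * inner a a| ≤ ∑ a ∈ I, |overlapW M H a a * inner a a| := abs_sum_le_sum_abs _ _
      _ ≤ ∑ _a ∈ I, (H : ℝ) * (B * (2 * (K : ℝ) ^ 2)) := by
          refine sum_le_sum fun a ha => ?_
          rw [abs_mul, abs_of_nonneg (overlapW_nonneg _ _ _ _)]
          have hw : overlapW M H a a ≤ H := by
            unfold overlapW; exact_mod_cast card_overlap_le (hIM a ha)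
          have hin : |inner a a| ≤ B * (2 * (K : ℝ) ^ 2) := by
            simp only [hinner]
            calc |∑ b ∈ J, ∑ b' ∈ J, overlapW M' K b b' * boxProd f c a a b b'|
                ≤ ∑ b ∈ J, |∑ b' ∈ J, overlapW M' K b b' * boxProd f c a a b b'| := abs_sum_le_sum_abs _ _
              _ ≤ ∑ b ∈ J, ∑ b' ∈ J, overlapW M' K b b' := by
                  refine sum_le_sum fun b _ => le_trans (abs_sum_le_sum_abs _ _) (sum_le_sum fun b' _ => ?_)
                  rw [abs_mul, abs_of_nonneg (overlapW_nonneg _ _ _ _)]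
                  exact mul_le_of_le_one_right (overlapW_nonneg _ _ _ _) (abs_boxProd_le hf _ _ _ _)
              _ ≤ ∑ _b ∈ J, 2 * (K : ℝ) ^ 2 := sum_le_sum fun b hb => by
                  unfold overlapW; exact sum_overlap_le J b (hJM b hb)
              _ = B * (2 * (K : ℝ) ^ 2) := by rw [sum_const, nsmul_eq_mul, hJcard]
          exact mul_le_mul hw hin (abs_nonneg _) (Nat.cast_nonneg _)
      _ = 2 * (I.card : ℝ) * B * H * (K : ℝ) ^ 2 := by rw [sum_const, nsmul_eq_mul]; ring
  -- (ii) the column-diagonal inside the strict upper row pairs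
  have hDb : |∑ a ∈ I, ∑ a' ∈ I.filter (fun a' => a < a'),
      overlapW M H a a' * ∑ b ∈ J, overlapW M' K b b * boxProd f c a a' b b| ≤
      2 * (I.card : ℝ) * B * (H : ℝ) ^ 2 * K := by
    calc |∑ a ∈ I, ∑ a' ∈ I.filter (fun a' => a < a'), overlapW M H a a' * ∑ b ∈ J, overlapW M' K b b * boxProd f c a a' b b|
        ≤ ∑ a ∈ I, ∑ a' ∈ I.filter (fun a' => a < a'), |overlapW M H a a' * ∑ b ∈ J, overlapW M' K b b * boxProd f c a a' b b| :=
          le_trans (abs_sum_le_sum_abs _ _) (sum_le_sum fun a _ => abs_sum_le_sum_abs _ _)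
      _ ≤ ∑ a ∈ I, ∑ a' ∈ I.filter (fun a' => a < a'), overlapW M H a a' * (B * K) := by
          refine sum_le_sum fun a _ => sum_le_sum fun a' _ => ?_
          rw [abs_mul, abs_of_nonneg (overlapW_nonneg _ _ _ _)]
          refine mul_le_mul_of_nonneg_left ?_ (overlapW_nonneg _ _ _ _)
          calc |∑ b ∈ J, overlapW M' K b b * boxProd f c a a' b b| ≤ ∑ b ∈ J, |overlapW M' K b b * boxProd f c a a' b b| :=
                abs_sum_le_sum_abs _ _
            _ ≤ ∑ _b ∈ J, (K : ℝ) := sum_le_sum fun b hb => by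
                rw [abs_mul, abs_of_nonneg (overlapW_nonneg _ _ _ _)]
                have hw : overlapW M' K b b ≤ K := by unfold overlapW; exact_mod_cast card_overlap_le (hJM b hb)
                calc overlapW M' K b b * |boxProd f c a a' b b| ≤ overlapW M' K b b * 1 :=
                      mul_le_mul_of_nonneg_left (abs_boxProd_le hf _ _ _ _) (overlapW_nonneg _ _ _ _)
                  _ ≤ K := by rw [mul_one]; exact hw
            _ = B * K := by rw [sum_const, nsmul_eq_mul, hJcard]
      _ ≤ ∑ a ∈ I, ∑ a' ∈ I, overlapW M H a a' * (B * K) := by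
          refine sum_le_sum fun a _ => sum_le_sum_of_subset_of_nonneg (filter_subset _ _) fun _ _ _ => ?_
          exact mul_nonneg (overlapW_nonneg _ _ _ _) (by positivity)
      _ ≤ ∑ _a ∈ I, 2 * (H : ℝ) ^ 2 * (B * K) := by
          refine sum_le_sum fun a ha => ?_
          rw [← sum_mul]
          apply mul_le_mul_of_nonneg_right _ (by positivity)
          unfold overlapW; exact sum_overlap_le I a (hIM a ha)
      _ = 2 * (I.card : ℝ) * B * (H : ℝ) ^ 2 * K := by rw [sum_const, nsmul_eq_mul]; ring
  -- (iii) the off-axes part = Σ_{h,k} (H−h)(K−k) 𝒞(h,k)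
  have hV : ∑ a ∈ I, ∑ a' ∈ I.filter (fun a' => a < a'),
      overlapW M H a a' * ∑ b ∈ J, ∑ b' ∈ J.filter (fun b' => b < b'), overlapW M' K b b' * boxProd f c a a' b b' =
      ∑ h ∈ Finset.Ico 1 H, ∑ k ∈ Finset.Ico 1 K, ((H - h : ℕ) : ℝ) * ((K - k : ℕ) : ℝ) * cornerRes f c A₁ A₂ B h k := by
    -- rows: vanish beyond the window, regroup by h, exact weight H − h
    rw [sum_upper_window I _ H (fun a _ a' _ hfar => by
      rw [show overlapW M H a a' = 0 by
        unfold overlapW; rw [card_overlap_eq_zero (by omega), Nat.cast_zero], zero_mul])]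
    have hrow : ∀ a ∈ I, ∀ h ∈ (Finset.Ico 1 H).filter (fun h => a + h ∈ I),
        overlapW M H a (a + h) = ((H - h : ℕ) : ℝ) := by
      intro a ha h hh
      rw [mem_filter, Finset.mem_Ico] at hh
      unfold overlapW
      rw [card_overlap_eq (hIM a ha) hh.1.2]
    rw [sum_congr rfl fun a ha => sum_congr rfl fun h hh => by rw [hrow a ha h hh]]
    -- columns: same, inside
    have hcol : ∀ a a' : ℕ, ∑ b ∈ J, ∑ b' ∈ J.filter (fun b' => b < b'), overlapW M' K b b' * boxProd f c a a' b b' =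
        ∑ b ∈ J, ∑ k ∈ (Finset.Ico 1 K).filter (fun k => b + k ∈ J), ((K - k : ℕ) : ℝ) * boxProd f c a a' b (b + k) := by
      intro a a'
      rw [sum_upper_window J _ K (fun b _ b' _ hfar => by
        rw [show overlapW M' K b b' = 0 by
          unfold overlapW; rw [card_overlap_eq_zero (by omega), Nat.cast_zero], zero_mul])]
      refine sum_congr rfl fun b hb => sum_congr rfl fun k hk => ?_
      rw [mem_filter, Finset.mem_Ico] at hk
      unfold overlapW
      rw [card_overlap_eq (hJM b hb) hk.1.2]
    simp_rw [hcol]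
    -- now swap: Σ_a Σ_h[filter] Σ_b Σ_k[filter] → Σ_h Σ_k Σ_a[filter] Σ_b[filter]
    rw [sum_filter_comm I (Finset.Ico 1 H)]
    refine sum_congr rfl fun h _ => ?_
    simp_rw [mul_sum]
    rw [sum_comm]
    -- goal: Σ_b∈J Σ_{a ∈ I.filter} Σ_{k ∈ filter} (H-h) * ((K-k) * box) = Σ_k (H-h)(K-k) cornerRes h k
    have : ∀ b ∈ J, ∑ a ∈ I.filter (fun a => a + h ∈ I), ∑ k ∈ (Finset.Ico 1 K).filter (fun k => b + k ∈ J),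
        ((H - h : ℕ) : ℝ) * (((K - k : ℕ) : ℝ) * boxProd f c a (a + h) b (b + k)) =
        ∑ k ∈ (Finset.Ico 1 K).filter (fun k => b + k ∈ J), ∑ a ∈ I.filter (fun a => a + h ∈ I),
        ((H - h : ℕ) : ℝ) * (((K - k : ℕ) : ℝ) * boxProd f c a (a + h) b (b + k)) := fun b _ => sum_comm
    rw [sum_congr rfl this, sum_filter_comm J (Finset.Ico 1 K)]
    refine sum_congr rfl fun k _ => ?_
    unfold cornerRes
    rw [← hI, ← hJ, mul_sum, sum_comm]
    refine sum_congr rfl fun a _ => ?_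
    rw [mul_sum]
    refine sum_congr rfl fun b _ => ?_
    ring
  -- bound on (iii)
  have hVbound : |∑ h ∈ Finset.Ico 1 H, ∑ k ∈ Finset.Ico 1 K, ((H - h : ℕ) : ℝ) * ((K - k : ℕ) : ℝ) * cornerRes f c A₁ A₂ B h k| ≤
      (H : ℝ) ^ 2 * (K : ℝ) ^ 2 * Mx := by
    calc |∑ h ∈ Finset.Ico 1 H, ∑ k ∈ Finset.Ico 1 K, ((H - h : ℕ) : ℝ) * ((K - k : ℕ) : ℝ) * cornerRes f c A₁ A₂ B h k|
        ≤ ∑ h ∈ Finset.Ico 1 H, ∑ k ∈ Finset.Ico 1 K, |((H - h : ℕ) : ℝ) * ((K - k : ℕ) : ℝ) * cornerRes f c A₁ A₂ B h k| :=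
          le_trans (abs_sum_le_sum_abs _ _) (sum_le_sum fun h _ => abs_sum_le_sum_abs _ _)
      _ ≤ ∑ _h ∈ Finset.Ico 1 H, ∑ _k ∈ Finset.Ico 1 K, (H : ℝ) * K * Mx := by
          refine sum_le_sum fun h hh => sum_le_sum fun k hk => ?_
          rw [abs_mul, abs_mul, abs_of_nonneg (Nat.cast_nonneg _), abs_of_nonneg (Nat.cast_nonneg _)]
          have h1 : ((H - h : ℕ) : ℝ) ≤ H := by exact_mod_cast Nat.sub_le H h
          have h2 : ((K - k : ℕ) : ℝ) ≤ K := by exact_mod_cast Nat.sub_le K k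
          have h3 := hMx h hh k hk
          have hMx0 : 0 ≤ Mx := le_trans (abs_nonneg _) h3
          exact mul_le_mul (mul_le_mul h1 h2 (Nat.cast_nonneg _) (Nat.cast_nonneg _)) h3 (abs_nonneg _) (by positivity)
      _ ≤ (H : ℝ) ^ 2 * (K : ℝ) ^ 2 * Mx := by
          rw [sum_const, sum_const, nsmul_eq_mul, nsmul_eq_mul, Nat.card_Ico, Nat.card_Ico]
          have h1 : ((H - 1 : ℕ) : ℝ) ≤ H := by exact_mod_cast Nat.sub_le H 1
          have h2 : ((K - 1 : ℕ) : ℝ) ≤ K := by exact_mod_cast Nat.sub_le K 1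
          calc ((H - 1 : ℕ) : ℝ) * (((K - 1 : ℕ) : ℝ) * ((H : ℝ) * K * Mx)) ≤ (H : ℝ) * ((K : ℝ) * ((H : ℝ) * K * Mx)) :=
                mul_le_mul h1 (mul_le_mul_of_nonneg_right h2 (by positivity)) (by positivity) (by positivity)
            _ = (H : ℝ) ^ 2 * (K : ℝ) ^ 2 * Mx := by ring
  -- assemble Q
  have hU : ∑ a ∈ I, ∑ a' ∈ I.filter (fun a' => a < a'), overlapW M H a a' * inner a a' =
      ∑ a ∈ I, ∑ a' ∈ I.filter (fun a' => a < a'), overlapW M H a a' * ∑ b ∈ J, overlapW M' K b b * boxProd f c a a' b b +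
      2 * ∑ a ∈ I, ∑ a' ∈ I.filter (fun a' => a < a'),
        overlapW M H a a' * ∑ b ∈ J, ∑ b' ∈ J.filter (fun b' => b < b'), overlapW M' K b b' * boxProd f c a a' b b' := by
    rw [mul_sum, ← sum_add_distrib]
    refine sum_congr rfl fun a _ => ?_
    rw [mul_sum, ← sum_add_distrib]
    refine sum_congr rfl fun a' _ => ?_
    rw [hinner_split]
    ring
  -- pure arithmetic on opaque reals (keeps `ring`/`linarith` away from the big sums)
  have arith : ∀ (q u v x1 x2 x3 b1 b2 b3 : ℝ), q = x1 + 2 * u → u = x2 + 2 * v → v = x3 →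
      |x1| ≤ b1 → |x2| ≤ b2 → |x3| ≤ b3 → |q| ≤ b1 + 2 * b2 + 4 * b3 := by
    intro q u v x1 x2 x3 b1 b2 b3 h1 h2 h3 h4 h5 h6
    subst h1; subst h2; subst h3
    rw [abs_le] at h4 h5 h6 ⊢
    constructor <;> linarith only [h4.1, h4.2, h5.1, h5.2, h6.1, h6.2]
  have hQbound : |Q| ≤ 2 * (I.card : ℝ) * B * H * (K : ℝ) ^ 2 + 2 * (2 * (I.card : ℝ) * B * (H : ℝ) ^ 2 * K) +
      4 * ((H : ℝ) ^ 2 * (K : ℝ) ^ 2 * Mx) :=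
    arith _ _ _ _ _ _ _ _ _ (hQ.trans hQsplit) hU hV hDa hDb hVbound
  -- finish (arithmetic on opaque reals again)
  have finish : ∀ (T m m' q i b hh kk mx : ℝ), hh ^ 2 * kk ^ 2 * T ≤ m * m' * q → 0 ≤ m → 0 ≤ m' →
      |q| ≤ 2 * i * b * hh * kk ^ 2 + 2 * (2 * i * b * hh ^ 2 * kk) + 4 * (hh ^ 2 * kk ^ 2 * mx) →
      hh ^ 2 * kk ^ 2 * T ≤ m * m' * (2 * i * b * hh * kk ^ 2 + 4 * i * b * hh ^ 2 * kk + 4 * hh ^ 2 * kk ^ 2 * mx) := by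
    intro T m m' q i b hh kk mx h1 hm hm' h2
    have h3 : q ≤ 2 * i * b * hh * kk ^ 2 + 4 * i * b * hh ^ 2 * kk + 4 * hh ^ 2 * kk ^ 2 * mx := by
      linarith only [le_abs_self q, h2]
    exact le_trans h1 (mul_le_mul_of_nonneg_left h3 (mul_nonneg hm hm'))
  have hfin := finish _ _ _ _ _ _ _ _ _ hcomb (Nat.cast_nonneg _) (Nat.cast_nonneg _) hQbound
  rw [hMcard, hM'card] at hfin
  exact hfin


/-- OFF-AXES CORNER CHOWLA — the REPAIRED transfer target of card `corner-local-box`, in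
restricted form (all four corners inside the table; both gaps `h, k ≥ 1`): every restricted
corner sum with gaps below `(log x)^K` is `≤ x/(log x)^K` in absolute value. Each is, by the
card's `block_det`, a binary Chowla sum `Σ_{a,b} λ(Q)λ(Q + hkc)` at the FIXED tiny shift `hkc`. -/
def OffAxesCornerChowla : Prop :=
  ∀ c : ℤ, c ≠ 0 → ∀ δ : ℝ, 0 < δ → δ ≤ 1 / 12 → ∀ K : ℝ, 0 < K → ∃ x₀ : ℝ, ∀ x : ℝ, x₀ ≤ x →
    ∀ A : ℝ, x ^ δ ≤ A → A ≤ x ^ (1 / 3 + δ) → ∀ h k : ℕ, 1 ≤ h → (h : ℝ) < Real.log x ^ K →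
      1 ≤ k → (k : ℝ) < Real.log x ^ K →
        |cornerRes lam c ⌊A⌋₊ ⌊2 * A⌋₊ ⌊x / A⌋₊ h k| ≤ x / Real.log x ^ K

/-- **CORNER REDUCTION, PROVED**: `OffAxesCornerChowla → TableChowla` (take `K = C + 1`,
`H = K = ⌊(log x)^{C+1}⌋`; corner domination gives `T ≤ 192·x²/(log x)^{C+1}`). This is the
first lemma `localBox_reduction` of card `corner-local-box` with its hypothesis REPAIRED
(`h ≠ 0 ∧ k ≠ 0`; restricted corners). -/
theorem tableChowla_of_offAxesCorners (h : OffAxesCornerChowla) : LiouvilleShiftedTables.TableChowla := by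
  rw [tableChowla_iff]
  intro c hc δ hδ hδ' C hC
  obtain ⟨x₀, hx₀⟩ := h c hc δ hδ hδ' (C + 1) (by linarith)
  obtain ⟨X₁, hX₁⟩ := eventually_log_rpow_le hδ (C + 1)
  refine ⟨max (max x₀ 4096) (max X₁ (Real.exp 192)), fun x hx A hA hA' => ?_⟩
  have hx₀x : x₀ ≤ x := le_trans (le_trans (le_max_left _ _) (le_max_left _ _)) hx
  have hx4096 : (4096 : ℝ) ≤ x := le_trans (le_trans (le_max_right _ _) (le_max_left _ _)) hx
  have hxX₁ : X₁ ≤ x := le_trans (le_trans (le_max_left _ _) (le_max_right _ _)) hx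
  have hxe : Real.exp 192 ≤ x := le_trans (le_trans (le_max_right _ _) (le_max_right _ _)) hx
  have hx1 : (1 : ℝ) ≤ x := by linarith
  have hxpos : 0 < x := by linarith
  have hlog : 192 ≤ Real.log x := (Real.le_log_iff_exp_le hxpos).mpr hxe
  have hlogpos : 0 < Real.log x := by linarith
  obtain ⟨h4, _⟩ := hX₁ x hxX₁
  have hAone : 1 ≤ A := le_trans (Real.one_le_rpow hx1 hδ.le) hA
  have hApos : 0 < A := by linarith
  -- Lr := (log x)^(C+1), Hn := ⌊Lr⌋
  set Lr : ℝ := Real.log x ^ (C + 1) with hLr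
  have hLrge : 192 ≤ Lr := by
    calc (192 : ℝ) ≤ Real.log x := hlog
      _ = Real.log x ^ (1 : ℝ) := (Real.rpow_one _).symm
      _ ≤ Lr := by rw [hLr]; exact Real.rpow_le_rpow_of_exponent_le (by linarith) (by linarith)
  set Hn : ℕ := ⌊Lr⌋₊ with hHndef
  have hHn1 : 1 ≤ Hn := by rw [hHndef, Nat.one_le_floor_iff]; linarith
  have hHnle : (Hn : ℝ) ≤ Lr := Nat.floor_le (by linarith)
  have hHnge : Lr / 2 ≤ Hn := by
    have := Nat.lt_floor_add_one Lr; rw [← hHndef] at this; linarith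
  have hHnpos : (0 : ℝ) < Hn := by exact_mod_cast hHn1
  have hLrA : Lr ≤ A := by linarith
  -- Bn and Hn ≤ Bn
  set Bn : ℕ := ⌊x / A⌋₊ with hBn
  have hBle : (Bn : ℝ) ≤ x / A := Nat.floor_le (by positivity)
  have hBge : x / A - 1 < Bn := by have := Nat.lt_floor_add_one (x / A); rw [← hBn] at this; linarith
  have hxA : x ^ ((7 : ℝ) / 12) ≤ x / A := by
    rw [le_div_iff₀ hApos]
    calc x ^ ((7 : ℝ) / 12) * A ≤ x ^ ((7 : ℝ) / 12) * x ^ (1 / 3 + δ) :=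
          mul_le_mul_of_nonneg_left hA' (by positivity)
      _ = x ^ ((7 : ℝ) / 12 + (1 / 3 + δ)) := by rw [← Real.rpow_add hxpos]
      _ ≤ x ^ (1 : ℝ) := Real.rpow_le_rpow_of_exponent_le hx1 (by linarith)
      _ = x := Real.rpow_one x
  have hx712 : x ^ δ ≤ x ^ ((7 : ℝ) / 12) := Real.rpow_le_rpow_of_exponent_le hx1 (by linarith)
  have hHnB : (Hn : ℝ) ≤ Bn := by nlinarith
  -- the corner hypothesis at this (x, A)
  set Mx : ℝ := x / Lr with hMx
  have hMx0 : 0 ≤ Mx := by positivity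
  have hcorner : ∀ h ∈ Finset.Ico 1 Hn, ∀ k ∈ Finset.Ico 1 Hn,
      |cornerRes lam c ⌊A⌋₊ ⌊2 * A⌋₊ Bn h k| ≤ Mx := by
    intro h hh k hk
    rw [Finset.mem_Ico] at hh hk
    have hh' : (h : ℝ) < Lr := lt_of_lt_of_le (by exact_mod_cast hh.2) hHnle
    have hk' : (k : ℝ) < Lr := lt_of_lt_of_le (by exact_mod_cast hk.2) hHnle
    have := hx₀ x hx₀x A hA hA' h k hh.1 hh' hk.1 hk'
    rw [← hBn] at this
    exact this
  have hdom := corner_domination (f := lam) (c := c) (A₁ := ⌊A⌋₊) (A₂ := ⌊2 * A⌋₊) (B := Bn)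
    abs_lam_le_one hHn1 hHn1 hMx0 hcorner
  -- sizes: N' ≤ 3A (indeed ≤ 2A + Hn), B' ≤ 2 Bn, rows ≤ 2A, Bn ≤ x/A
  have hrows : ((Ioc ⌊A⌋₊ ⌊2 * A⌋₊).card : ℝ) ≤ 2 * A := by
    rw [Nat.card_Ioc, Nat.cast_sub (Nat.floor_le_floor (by linarith : A ≤ 2 * A))]
    have h1 : (⌊2 * A⌋₊ : ℝ) ≤ 2 * A := Nat.floor_le (by linarith)
    have h2 : A - 1 < (⌊A⌋₊ : ℝ) := by have := Nat.lt_floor_add_one A; linarith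
    linarith
  have hN' : ((⌊2 * A⌋₊ + Hn - 1 - ⌊A⌋₊ : ℕ) : ℝ) ≤ 3 * A := by
    have h1 : (⌊2 * A⌋₊ : ℝ) ≤ 2 * A := Nat.floor_le (by linarith)
    have h2 : ((⌊2 * A⌋₊ + Hn - 1 - ⌊A⌋₊ : ℕ) : ℝ) ≤ ((⌊2 * A⌋₊ + Hn : ℕ) : ℝ) := by
      exact_mod_cast (show ⌊2 * A⌋₊ + Hn - 1 - ⌊A⌋₊ ≤ ⌊2 * A⌋₊ + Hn by omega)
    push_cast at h2
    linarith
  have hB' : ((Bn + Hn - 1 : ℕ) : ℝ) ≤ 2 * Bn := by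
    have h2 : ((Bn + Hn - 1 : ℕ) : ℝ) ≤ ((Bn + Hn : ℕ) : ℝ) := by exact_mod_cast Nat.sub_le _ _
    push_cast at h2
    linarith
  have hABx : A * (Bn : ℝ) ≤ x := by
    calc A * (Bn : ℝ) ≤ A * (x / A) := mul_le_mul_of_nonneg_left hBle hApos.le
      _ = x := by field_simp
  -- arithmetic on opaque reals: Hn⁴ T ≤ N' B' (2 N Bn Hn Hn² + 4 N Bn Hn² Hn + 4 Hn⁴ Mx) ⟹ Lr T ≤ 192 x²
  have arith : ∀ (T n' b' n bn hn a xx lr mx : ℝ),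
      hn ^ 2 * hn ^ 2 * T ≤ n' * b' * (2 * n * bn * hn * hn ^ 2 + 4 * n * bn * hn ^ 2 * hn + 4 * hn ^ 2 * hn ^ 2 * mx) →
      0 < hn → n' ≤ 3 * a → b' ≤ 2 * bn → n ≤ 2 * a → a * bn ≤ xx → 0 ≤ n' → 0 ≤ b' → 0 ≤ n → 0 ≤ bn → 0 ≤ a →
      0 ≤ T → 0 ≤ mx → lr / 2 ≤ hn → hn ≤ lr → lr * mx = xx → 0 ≤ xx →
      lr * T ≤ 192 * xx ^ 2 := by
    intro T n' b' n bn hn a xx lr mx h1 hhn hn' hb' hnle hab hn'0 hb'0 hn0 hbn0 ha0 hT0 hmx0 hlr1 hlr2 hlrmx hxx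
    have habn : 0 ≤ a * bn := mul_nonneg ha0 hbn0
    have hhn0 : 0 ≤ hn := hhn.le
    have hbracket : 0 ≤ 2 * n * bn * hn * hn ^ 2 + 4 * n * bn * hn ^ 2 * hn + 4 * hn ^ 2 * hn ^ 2 * mx := by positivity
    -- step A: n' b' ≤ 6 a bn
    have hA1 : n' * b' ≤ 6 * (a * bn) := by
      calc n' * b' ≤ (3 * a) * (2 * bn) := mul_le_mul hn' hb' hb'0 (by positivity)
        _ = 6 * (a * bn) := by ring
    have hA2 : hn ^ 2 * hn ^ 2 * T ≤ 6 * (a * bn) * (2 * n * bn * hn * hn ^ 2 + 4 * n * bn * hn ^ 2 * hn + 4 * hn ^ 2 * hn ^ 2 * mx) :=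
      le_trans h1 (mul_le_mul_of_nonneg_right hA1 hbracket)
    -- step B: the bracket ≤ hn³ (12 a bn + 4 hn mx)
    have hnbn : n * bn ≤ 2 * a * bn := mul_le_mul_of_nonneg_right hnle hbn0
    have hA3 : 2 * n * bn * hn * hn ^ 2 + 4 * n * bn * hn ^ 2 * hn + 4 * hn ^ 2 * hn ^ 2 * mx ≤
        hn ^ 3 * (12 * (a * bn) + 4 * hn * mx) := by
      have hh3 : 0 ≤ hn ^ 3 := pow_nonneg hhn0 3
      calc 2 * n * bn * hn * hn ^ 2 + 4 * n * bn * hn ^ 2 * hn + 4 * hn ^ 2 * hn ^ 2 * mx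
          = hn ^ 3 * (6 * (n * bn)) + 4 * hn ^ 3 * hn * mx := by ring
        _ ≤ hn ^ 3 * (6 * (2 * a * bn)) + 4 * hn ^ 3 * hn * mx := by
            have := mul_le_mul_of_nonneg_left (mul_le_mul_of_nonneg_left hnbn (by norm_num : (0:ℝ) ≤ 6)) hh3
            linarith
        _ = hn ^ 3 * (12 * (a * bn) + 4 * hn * mx) := by ring
    have hA4 : hn ^ 2 * hn ^ 2 * T ≤ 6 * (a * bn) * (hn ^ 3 * (12 * (a * bn) + 4 * hn * mx)) :=
      le_trans hA2 (mul_le_mul_of_nonneg_left hA3 (by positivity))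
    -- step C: divide by hn³
    have hA5 : hn * T ≤ 6 * (a * bn) * (12 * (a * bn) + 4 * hn * mx) := by
      have hh3 : 0 < hn ^ 3 := pow_pos hhn 3
      have : hn ^ 3 * (hn * T) ≤ hn ^ 3 * (6 * (a * bn) * (12 * (a * bn) + 4 * hn * mx)) := by
        calc hn ^ 3 * (hn * T) = hn ^ 2 * hn ^ 2 * T := by ring
          _ ≤ _ := hA4
          _ = _ := by ring
      exact le_of_mul_le_mul_left this hh3
    -- step D: a bn ≤ xx
    have hA6 : hn * T ≤ 72 * xx ^ 2 + 24 * xx * (hn * mx) := by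
      have hsq : (a * bn) ^ 2 ≤ xx ^ 2 := pow_le_pow_left₀ habn hab 2
      have hcross : (a * bn) * (hn * mx) ≤ xx * (hn * mx) := mul_le_mul_of_nonneg_right hab (mul_nonneg hhn0 hmx0)
      calc hn * T ≤ 6 * (a * bn) * (12 * (a * bn) + 4 * hn * mx) := hA5
        _ = 72 * (a * bn) ^ 2 + 24 * ((a * bn) * (hn * mx)) := by ring
        _ ≤ 72 * xx ^ 2 + 24 * (xx * (hn * mx)) := by linarith
        _ = 72 * xx ^ 2 + 24 * xx * (hn * mx) := by ring
    -- step E: lr T ≤ 2 hn T and hn mx ≤ lr mx = xx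
    have hA7 : xx * (hn * mx) ≤ xx * (lr * mx) := mul_le_mul_of_nonneg_left (mul_le_mul_of_nonneg_right hlr2 hmx0) hxx
    rw [hlrmx] at hA7
    have hA8 : lr * T ≤ 2 * (hn * T) := by
      have := mul_le_mul_of_nonneg_right hlr1 hT0
      linarith
    calc lr * T ≤ 2 * (hn * T) := hA8
      _ ≤ 2 * (72 * xx ^ 2 + 24 * xx * (hn * mx)) := by linarith
      _ = 144 * xx ^ 2 + 48 * (xx * (hn * mx)) := by ring
      _ ≤ 144 * xx ^ 2 + 48 * (xx * xx) := by linarith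
      _ = 192 * xx ^ 2 := by ring
  have hfin := arith _ _ _ _ _ _ _ _ _ _ hdom hHnpos hN' hB' hrows hABx (Nat.cast_nonneg _) (Nat.cast_nonneg _)
    (Nat.cast_nonneg _) (Nat.cast_nonneg _) hApos.le momentN_nonneg hMx0 hHnge hHnle
    (by rw [hMx]; field_simp) hxpos.le
  -- Lr T ≤ 192 x², Lr = (log x)^C · log x, log x ≥ 192
  have hsplit : Lr = Real.log x ^ C * Real.log x := by rw [hLr, Real.rpow_add hlogpos, Real.rpow_one]
  have hLpos : 0 < Real.log x ^ C := Real.rpow_pos_of_pos hlogpos C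
  show momentN lam c ⌊A⌋₊ ⌊2 * A⌋₊ ⌊x / A⌋₊ ≤ x ^ 2 / Real.log x ^ C
  rw [← hBn, le_div_iff₀ hLpos]
  rw [hsplit] at hfin
  have hT0 : 0 ≤ momentN lam c ⌊A⌋₊ ⌊2 * A⌋₊ Bn := momentN_nonneg
  have h2 : momentN lam c ⌊A⌋₊ ⌊2 * A⌋₊ Bn * Real.log x ^ C * Real.log x ≤ x ^ 2 * Real.log x := by
    calc momentN lam c ⌊A⌋₊ ⌊2 * A⌋₊ Bn * Real.log x ^ C * Real.log x
        = Real.log x ^ C * Real.log x * momentN lam c ⌊A⌋₊ ⌊2 * A⌋₊ Bn := by ring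
      _ ≤ 192 * x ^ 2 := hfin
      _ ≤ Real.log x * x ^ 2 := mul_le_mul_of_nonneg_right hlog (sq_nonneg x)
      _ = x ^ 2 * Real.log x := by ring
  exact le_of_mul_le_mul_right h2 hlogpos

end

end Summit.Parity.GeneralizedHardyLittlewood.Cruxes.TableChowla.DisproofBands
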